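import Literature.Geometry.Kaehler.ComplexTorusPositiveLineBundleDolbeaultVanishing
import Literature.Geometry.Kaehler.ComplexTorusLineBundleTwistTransport
import Literature.Geometry.Kaehler.ComplexTorusHarmonicRiemannRoch
import HarnessLib

/-!
# Theorem 1.6.1 and Mumford's index theorem (Lange 2023, Thm. 1.6.4 / Thm. 1.6.8 with `r + s = g`) for a
# NON-DEGENERATE line bundle on a complex torus: `ℋ^q(L) ≅ H^{0,q}_{∂̄}(X, L)` for all `q`,
# `H^{0,q}_{∂̄}(X, L) = 0` for `q ≠ s`, `h^s(L) = d_1 ⋯ d_g`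

Layer `Literature/Geometry/Kaehler`, namespace `Literature.Geometry.Kaehler.ComplexTorus`; lane `lit-hodgefound`,
Layer A2, row A2-93 FILE 2 of `run/shared/lean/pub/lit-hodgefound/SKELETON.md` (seat `lit-hodgefound-skel-2`).
DEFINITION WITH BODY (`IsNSForm.harmonicFormsEquivDbarCohomology`) and THEOREMS; no named fact, no `sorry`.

Let `X = V/Λ`, `L = L(H, χ)` with `H ∈ NS(X)` NON-DEGENERATE of index `s`, `e_ν = w ν` an `H`-orthogonal
complex basis with real diagonal `c_ν = H(e_ν, e_ν) ≠ 0` (`horth`), `N = {ν | c_ν < 0}` (`#N = s`), `k_ν > 0`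
Kähler weights.  Row A2-77 FILE 4 (`ComplexTorusHarmonicFormsTwist`) built Lange's auxiliary torus of §1.6.3:
the complex structure `k = j` on `W_+`, `-j` on `W_-` (`twistJ`), a complex space `U ≅_ℝ W` realising it
(`κ : E ≃L[ℝ] U`, `κ (k v) = i κ v`), `Y = U/Λ = ComplexTorus (Φ.trans κ)`, `H̃` (`twistForm`), `M = L(H̃, χ)`,
the weight `f = e^{-π H(w_-, w_-)}` (`twistWeight`) and the isomorphism (1.31) `ℋ_N(L) ≅ H⁰(Y, M)`,
`φ ↦ (φ f) ∘ κ⁻¹` (`twistThetaEquiv`, Prop. 1.6.10).  For non-degenerate `H`, `H̃` is POSITIVE DEFINITE (FILE 1,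
`isRiemannForm_twistForm`), so row A2-92 (`ComplexTorusPositiveLineBundleDolbeaultVanishing`: the Fock expansion
of `A^{0,0}(M)` and its Green operator) applies on `Y`; this file transports it back to `X` along (1.31), using
FILE 1's letters and isometry, and proves the Hodge theorem for `L`.

## Contents

FILE 1 of the row (`ComplexTorusLineBundleTwistTransport`) extends (1.31) to all smooth sections: the transport
`T φ = (φ f) ∘ κ⁻¹` (`twistFun`/`untwistFun`, `A^{0,0}(L) ≅ A^{0,0}(M)`), the four letters
(`∂̄^M_{κ e_ν} T = T ∂̄^L_{e_ν}`, `δ̄^M T = T δ̄^L` off `N`; `∂̄^M_{κ e_ν} T = -T δ̄^L_{e_ν}`, `δ̄^M T = -T ∂̄^L` on `N`),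
`H̃` a Riemann form for non-degenerate `H` (`isRiemannForm_twistForm`), the `ℂ`-basis `κ e_ν` of `U` (`twistBasis`)
and the isometry `(T f, T g)_M = (f, g)_L` (`ahInner_twistFun`).  Here:

* §1 the `H̃`-diagonal of `κ e_ν` is `|c_ν|` (`frameDiag_twistForm`, `frameDiag_twistForm_pos`), `‖T f‖_M = ‖f‖_L`;
* §2 on `Y`: `∂̄_ν δ̄_ν` on Fock series (`IsFockData.dbarAlong_deltaBar_basis_fockSeries`), the creation-side key
  identity `λ_{J ∪ ν}(β - 1_ν) = λ_J(β)` (`creShift_greenData_insert`), the Green data `G_∅` with the vacuum mode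
  sent to `0` (`IsFockData.greenData_empty`, `fockEigenvalue_smul_greenData_empty`), the vacuum datum
  (`IsFockData.vacuum`, `fockSeries_vacuum`), and **the eigenvalue dictionary
  `Σ_ν k_ν^{-1} π h̃_ν (α_ν + [ν ∈ N]) + π Σ_{ν∈I} k_ν^{-1} c_ν = λ^M_{I ∆ N}(α)`** (`fockEigenvalue_symmDiff`);
* §3 **`Δ^L_I T⁻¹(Σ_α δ̄_M^α κ̃_α) = T⁻¹(Σ_α λ^M_{I∆N}(α) δ̄_M^α κ̃_α)`** (`laplaceI_untwistFun_fockSeries`) and the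
  **mixed Fock expansion of `A^{0,0}(L)`**: every `φ ∈ A^{0,0}(L)` is `T⁻¹ Σ_α δ̄_M^α κ̃_α` for unique rapidly
  decreasing `H⁰(Y, M)`-valued data (`exists_isFockData_untwistFun_fockSeries_eq`, `eq_of_untwistFun_fockSeries_eq`);
* §4 **THEOREM `IsNSForm.exists_harmonic_sub_mem_dbarExactForms`**: every `σ ∈ Z^{0,q}_{∂̄}(X, L)` differs from the
  harmonic form `h = T⁻¹(κ̃^N_0) dv̄_N ∈ ℋ^q(L)` by a `∂̄`-exact form — with `τ_I = T⁻¹ Σ_α δ̄_M^α (κ̃^I_α/λ_{I∆N}(α))`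
  one has `Δτ = σ - h` and `∂̄τ = 0` (`∂̄ G = G ∂̄`: `twistLetter_greenData_erase`; uniqueness of the data of
  `∂̄σ = 0`), so `σ - h = ∂̄(δ̄ τ)`; hence **`ℋ^q(L) → H^{0,q}_{∂̄}(X, L)` is bijective**
  (`IsNSForm.harmonicToDolbeault_bijective_of_nondegenerate`; injectivity is row A2-79);
* §5 the statements on `X` alone, with `U = ℂ^g` in the coordinates (1.30) (`twistCoord`): **Theorem 1.6.1 for
  non-degenerate `L`** (`IsNSForm.harmonicToDolbeault_bijective_of_ne_zero`,
  `IsNSForm.harmonicFormsEquivDbarCohomology`, `finrank_dbarCohomology_eq_finrank_harmonicForms`), and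
  **Mumford's index theorem** in the `∂̄`-cohomology of A2-79: `H^{0,q}_{∂̄}(X, L) = 0` for `q ≠ s`
  (`IsNSForm.subsingleton_dbarCohomology_of_ne_index`, `finrank_…_eq_zero_of_ne_index`, `rank_…`), and
  `dim_ℂ H^{0,s}_{∂̄}(X, L) = d_1 ⋯ d_g` (`IsNSForm.finrank_dbarCohomology_index_eq_prod`, `…_hermIndex_eq_prod`, from
  row A2-77's Thm. 1.6.8 for `ℋ^s`);
* §6 **the Riemann–Roch theorem for non-degenerate `L` in the `∂̄`-cohomology** (Lange Thm. 1.7.3 with Thm. 1.7.1):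
  the non-degeneracy and radical hypotheses discharged from `c_ν ≠ 0` (row A2-78's `nondegenerate_of_diag_ne_zero`,
  `semichar_radical_eq_one_of_nondegenerate`), the table `dim_ℂ H^{0,q}_{∂̄}(X, L) = [q = s] · d_1 ⋯ d_g`
  (`IsNSForm.finrank_dbarCohomology_eq_ite`), `χ(L) = Σ_q (-1)^q h^q(L) = (-1)^s d_1 ⋯ d_g`
  (`IsNSForm.eulerChar_dbarCohomology_eq`) and **`g! · χ(L) = (L^g) = ∫_X (-E)^{∧g}`**
  (`IsNSForm.riemannRoch_of_nondegenerate`, with row Q81's `IsNSForm.torusIntegral_wedgePow_neg_of_isPolarizationType`);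
* §7 **example — the Poincaré bundle `𝒫` on `X × X̂` (§1.6.4 Exercise (4) "`h^q(𝒫) = ℂ` if `q = g`, `0` if `q ≠ g`")
  in the `∂̄`-cohomology**: `dim_ℂ H^{0,q}_{∂̄}(X × X̂, 𝒫) = [q = g]` (`finrank_dbarCohomology_poincare`,
  `subsingleton_dbarCohomology_poincare`) and `χ(𝒫) = (-1)^g` (`eulerChar_dbarCohomology_poincare`), from §6 with
  rows A2-30 (`poincareForm`, `poincareChar`), Q81 (`hermIndex_poincareForm`: index `g`; non-degeneracy) and
  `isPolarizationType_poincareForm` (type `(1, …, 1)`); row A2-78 has the same counts for `ℋ^q(𝒫)`.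

* §8 **`h^q(L) = h^{g-q}(L⁻¹)`** for non-degenerate `L`, `q ≤ g` (the dimension form of §1.6.2 (1.27)
  "`H^q(L) ≃ H^{g-q}(L^{-1})`"): `IsNSForm.hermIndex_neg_eq_of_orthogonal` (index of `L⁻¹ = L(-H, χ⁻¹)` is `g - s`),
  `IsNSForm.exists_isPolarizationType_of_orthogonal` (a type indexed by the frame),
  `IsNSForm.finrank_dbarCohomology_eq_finrank_dbarCohomology_inv`.

* §9 junction with row A2-78: **`χ_∂̄(L) = χ_ℋ(L)`** (`IsNSForm.eulerChar_dbarCohomology_eq_harmonicEulerChar`) and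
  **Cor. 1.7.2 "`deg φ_L = χ(L)²`"** in the `∂̄`-cohomology, type-free (`IsNSForm.polarizationDegree_eq_eulerChar_dbarCohomology_sq`,
  `IsNSForm.natCard_kerPhiH_eq_eulerChar_dbarCohomology_sq`).

In §§5–9 the statements about `H^{0,q}_{∂̄}` alone carry no Kähler weights (the proofs run with `k_ν = 1`); the
weights `k` appear only where `ℋ^q(L) = Ker Δ_k` does.

Printed sources followed: Lange 2023 §1.6.3 (1.29)–(1.31), Prop. 1.6.10 Steps 1–2 [p0068–p0070] for the
transport; §1.6.1 Prop. 1.6.3 for `Δ_I`; Folland 1989 §1.7 (vii) for the Fock expansion (row A2-92).  The theorem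
proved is Lange's Thm. 1.6.1 "`H^q(X, L) ≅ ℋ^q(L)`" [p0063] for non-degenerate `L` together with Thm. 1.6.4 /
Thm. 1.6.8 [p0066, p0068] "`h^q(L) = Pf(E)` if `q = s(L)`, `0` otherwise" read in the `∂̄`-cohomology
`H^{0,q}_{∂̄}(X, L)` of A2-79 (whose identification with sheaf cohomology is A2-79's cited convention).  Lange
proves 1.6.4/1.6.8 from 1.6.1 (quoted from Griffiths–Harris) + the harmonic computation; here 1.6.1 itself is
proved for non-degenerate `L`, by the Fock expansion.  Degenerate `L` (`r + s < g`) is NOT treated.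

## References

* [Lange2023AbelianVarietiesComplex] H. Lange, *Abelian Varieties over the Complex Numbers*, Springer 2023,
  §1.6.1 Prop. 1.6.3, Thm. 1.6.1 [p0063–p0065]; §1.6.2 Thm. 1.6.4, (1.27) [p0064, p0066]; §1.6.3 (1.29)–(1.31), Thm. 1.6.8,
  Prop. 1.6.10, Prop. 1.6.11 [p0068–p0070]; §1.6.4 Exercise (4) [p0071]; §1.7.1 Thm. 1.7.1, Cor. 1.7.2, §1.7.2 Thm. 1.7.3,
  Lemma 1.7.5 [p0071–p0073]; §1.4.2 Prop. 1.4.7.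
* [Folland1989] G. B. Folland, *Harmonic Analysis in Phase Space*, Princeton UP 1989, §1.7 (vii).
* [HuybrechtsCG2005] D. Huybrechts, *Complex Geometry*, Springer 2005, Def. 2.6.24, Cor. 4.1.14.

[cite: Lange2023AbelianVarietiesComplex, §1.6.3 Prop. 1.6.10] [cite: Lange2023AbelianVarietiesComplex, §1.6.1 Thm. 1.6.1]
-/

noncomputable section

open scoped Manifold ContDiff Topology Real ComplexConjugate
open Set Filter Function Complex MeasureTheory Finset
open Literature.Analysis.Complex

namespace Literature.Geometry.Kaehler

namespace ComplexTorus

/-! ## §1 The `H̃`-diagonal `|c_ν|` of the frame `κ e_ν`; `‖T f‖_M = ‖f‖_L` -/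

section TwistFrameDiag

variable {ι : Type*} [Fintype ι] {E : Type*} [NormedAddCommGroup E] [NormedSpace ℂ E]
  {U : Type*} [NormedAddCommGroup U] [NormedSpace ℂ U] {g : ℕ}
  {η : E [⋀^Fin 2]→L[ℝ] ℝ} {w : Module.Basis (Fin g) ℂ E} {c : Fin g → ℝ} {N : Finset (Fin g)} {κ : E ≃L[ℝ] U}
  {Φ : (ι → ℝ) ≃L[ℝ] E}
  (horth : ∀ k l, hermOf η (w k) (w l) = if k = l then (c k : ℂ) else 0)
  (h11 : ∀ u v : E, η ![I • u, I • v] = η ![u, v]) (hκ : ∀ v, κ (twistJ w N v) = I • κ v)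
include horth h11 hκ

omit [Fintype ι] in
/-- **The diagonal of `H̃` in the frame `κ e_ν` is `|c_ν|`**: `h̃_ν = Ẽ(i κ e_ν, κ e_ν) = -c_ν` on `N`, `c_ν` off `N`.
[cite: Lange2023AbelianVarietiesComplex, §1.6.3 Prop. 1.6.10] -/
theorem frameDiag_twistForm (ν : Fin g) :
    frameDiag (twistForm η κ) (κ ∘ w) ν = if ν ∈ N then -c ν else c ν := by
  have h := hermOf_twistForm_basis_basis horth h11 hκ ν ν
  rw [if_pos rfl, hermOf_self] at h
  rw [frameDiag_apply, Function.comp_apply]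
  exact_mod_cast h

omit [Fintype ι] in
/-- For `c_ν < 0` on `N` and `c_ν > 0` off `N` the diagonal `h̃_ν = |c_ν|` is positive.
[cite: Lange2023AbelianVarietiesComplex, §1.6.3 Prop. 1.6.10] -/
theorem frameDiag_twistForm_pos (hcS : ∀ ν ∉ N, 0 < c ν) (hcN : ∀ ν ∈ N, c ν < 0) (ν : Fin g) :
    0 < frameDiag (twistForm η κ) (κ ∘ w) ν := by
  rw [frameDiag_twistForm horth h11 hκ]
  split_ifs with h
  · linarith [hcN ν h]
  · exact hcS ν h

/-- **`‖T f‖_M = ‖f‖_L`.** [cite: Lange2023AbelianVarietiesComplex, §1.6.3 Prop. 1.6.10 (1.31)] -/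
theorem ahNorm_twistFun [FiniteDimensional ℂ E] {χ : (ι → ℤ) → ℂ} (hη : IsNSForm Φ η) (hχ : IsSemicharacter Φ η χ)
    {f : E → ℂ} (hf : f ∈ smoothTheta Φ (canonicalFactor Φ η χ)) :
    ahNorm (Φ.trans κ) (twistForm η κ) (twistFun η w N κ f) = ahNorm Φ η f := by
  rw [ahNorm, ahNorm, ahInner_twistFun horth h11 hκ hη hχ hf hf]

end TwistFrameDiag

/-! ## §2 On `Y`: `∂̄_ν δ̄_ν` on Fock series, the creation-side key identity, the Green data `G_∅` with the vacuum
mode removed, the vacuum datum, and the eigenvalue dictionary `Δ^L_I ↔ λ^M_{I ∆ N}` -/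

section MixedFock

variable {ι : Type*} [Fintype ι] {E : Type*} [NormedAddCommGroup E] [NormedSpace ℂ E] [FiniteDimensional ℂ E]
  {U : Type*} [NormedAddCommGroup U] [NormedSpace ℂ U] [FiniteDimensional ℂ U] {g : ℕ}
  {η : E [⋀^Fin 2]→L[ℝ] ℝ} {w : Module.Basis (Fin g) ℂ E} {c : Fin g → ℝ} {N : Finset (Fin g)} {κ : E ≃L[ℝ] U}
  {Φ : (ι → ℝ) ≃L[ℝ] E} {χ : (ι → ℤ) → ℂ} {k : Fin g → ℝ}

omit [Fintype ι] [FiniteDimensional ℂ E] [FiniteDimensional ℂ U] in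
/-- The basis `κ e_ν`, evaluated. [cite: Lange2023AbelianVarietiesComplex, §1.6.3 (1.30)] -/
@[simp] theorem twistBasis_apply (hκ : ∀ v, κ (twistJ w N v) = I • κ v) (ν : Fin g) : twistBasis hκ ν = κ (w ν) := by
  rw [coe_twistBasis]; rfl

omit [FiniteDimensional ℂ E] in
/-- **`∂̄_ν δ̄_ν (Σ_α δ̄^α κ_α) = Σ_α π h_ν (α_ν + 1) δ̄^α κ_α`** (the CCR `[∂̄_ν, δ̄_ν] = π h_ν` on Fock data; any
positive frame). [cite: Lange2023AbelianVarietiesComplex, §1.6.1 Prop. 1.6.3] -/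
theorem IsFockData.dbarAlong_deltaBar_basis_fockSeries {Φ' : (ι → ℝ) ≃L[ℝ] U} {η' : U [⋀^Fin 2]→L[ℝ] ℝ}
    {bB : Module.Basis (Fin g) ℂ U} (hη : IsNSForm Φ' η') (hχ : IsSemicharacter Φ' η' χ)
    (hb : ∀ μ ν, μ ≠ ν → hermOf η' (bB μ) (bB ν) = 0) (hpos : ∀ ν, 0 < frameDiag η' bB ν)
    {κ' : (Fin g → ℕ) → U → ℂ} (hκ' : IsFockData Φ' η' χ bB κ') (ν : Fin g) :
    dbarAlong (bB ν) (deltaBar η' (bB ν) (fockSeries η' bB κ')) =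
      fockSeries η' bB (fun α ↦ (((π * frameDiag η' bB ν * ((α ν : ℝ) + 1) : ℝ)) : ℂ) • κ' α) := by
  rw [hκ'.deltaBar_basis_fockSeries hη hχ hb hpos ν, (hκ'.creShift hpos ν).dbarAlong_basis_fockSeries hη hχ hb hpos ν]
  congr 1
  funext β
  rw [annData_apply, creShift_add_single]

omit [Fintype ι] [FiniteDimensional ℂ U] in
/-- **`λ_{J ∪ {ν}}(β - 1_ν) = λ_J(β)` for `ν ∉ J`, `β_ν ≥ 1`** — the creation-side twin of
`fockEigenvalue_erase_add_single`. [cite: Lange2023AbelianVarietiesComplex, §1.6.1 Prop. 1.6.3] -/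
theorem fockEigenvalue_insert_sub_single {η' : U [⋀^Fin 2]→L[ℝ] ℝ} {b : Fin g → U} {J : Finset (Fin g)} {ν : Fin g}
    (hν : ν ∉ J) {β : Fin g → ℕ} (hβ : β ν ≠ 0) :
    fockEigenvalue η' b k (insert ν J) (β - Pi.single ν 1) = fockEigenvalue η' b k J β := by
  have h := fockEigenvalue_erase_add_single (η := η') (b := b) (k := k) (Finset.mem_insert_self ν J) (β - Pi.single ν 1)
  rw [Finset.erase_insert hν, tsub_add_cancel_of_le] at h
  · exact h.symm
  · intro μ
    by_cases hμ : μ = ν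
    · subst hμ; rw [Pi.single_eq_same]; exact Nat.one_le_iff_ne_zero.2 hβ
    · rw [Pi.single_eq_of_ne hμ]; exact Nat.zero_le _

omit [Fintype ι] [FiniteDimensional ℂ U] in
/-- **`S_ν (G_{J ∪ {ν}} κ) = G_J (S_ν κ)` for `ν ∉ J`** — the creation shift commutes with the Green data up to the
change of index set. [cite: Lange2023AbelianVarietiesComplex, §1.6.1 Prop. 1.6.3] -/
theorem creShift_greenData_insert {η' : U [⋀^Fin 2]→L[ℝ] ℝ} {b : Fin g → U} {J : Finset (Fin g)} {ν : Fin g}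
    (hν : ν ∉ J) (κ' : (Fin g → ℕ) → U → ℂ) :
    ComplexTorus.creShift ν (greenData η' b k (insert ν J) κ') = greenData η' b k J (ComplexTorus.creShift ν κ') := by
  funext β
  by_cases hβ : β ν = 0
  · rw [greenData_apply, show ComplexTorus.creShift ν κ' β = 0 from if_pos hβ,
      show ComplexTorus.creShift ν (greenData η' b k (insert ν J) κ') β = 0 from if_pos hβ, smul_zero]
  · rw [greenData_apply, show ComplexTorus.creShift ν κ' β = κ' (β - Pi.single ν 1) from if_neg hβ,
      show ComplexTorus.creShift ν (greenData η' b k (insert ν J) κ') β =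
        greenData η' b k (insert ν J) κ' (β - Pi.single ν 1) from if_neg hβ, greenData_apply,
      fockEigenvalue_insert_sub_single hν hβ]

omit [Fintype ι] [FiniteDimensional ℂ U] in
/-- `λ_∅(α) ≥ m |α|`-type bound: there is `m > 0` with `m ≤ λ_∅(α)` for all `α ≠ 0` (positive frame and weights).
[cite: Lange2023AbelianVarietiesComplex, §1.6.2 Lemma 1.6.6] -/
theorem exists_pos_le_fockEigenvalue_empty {η' : U [⋀^Fin 2]→L[ℝ] ℝ} {b : Fin g → U}
    (hpos : ∀ ν, 0 < frameDiag η' b ν) (hk : ∀ ν, 0 < k ν) :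
    ∃ m : ℝ, 0 < m ∧ ∀ α : Fin g → ℕ, α ≠ 0 → m ≤ fockEigenvalue η' b k ∅ α := by
  classical
  by_cases hg : (Finset.univ : Finset (Fin g)).Nonempty
  · refine ⟨Finset.univ.inf' hg fun ν ↦ (k ν)⁻¹ * (π * frameDiag η' b ν), ?_, fun α hα ↦ ?_⟩
    · exact (Finset.lt_inf'_iff hg).2 fun ν _ ↦ mul_pos (inv_pos.2 (hk ν)) (mul_pos Real.pi_pos (hpos ν))
    · obtain ⟨μ, hμ⟩ : ∃ μ, α μ ≠ 0 := by
        by_contra h; push Not at h; exact hα (funext h)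
      have h1 : ∀ ν, 0 ≤ (k ν)⁻¹ * (π * frameDiag η' b ν * α ν) := fun ν ↦
        mul_nonneg (inv_nonneg.2 (hk ν).le) (mul_nonneg (mul_pos Real.pi_pos (hpos ν)).le (Nat.cast_nonneg _))
      rw [fockEigenvalue_apply, Finset.sum_empty, mul_zero, add_zero]
      calc Finset.univ.inf' hg (fun ν ↦ (k ν)⁻¹ * (π * frameDiag η' b ν))
          ≤ (k μ)⁻¹ * (π * frameDiag η' b μ) := Finset.inf'_le _ (Finset.mem_univ μ)
        _ ≤ (k μ)⁻¹ * (π * frameDiag η' b μ * α μ) := by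
            have hk' : 0 ≤ (k μ)⁻¹ := inv_nonneg.2 (hk μ).le
            have h1' : (1 : ℝ) ≤ α μ := by exact_mod_cast Nat.one_le_iff_ne_zero.2 hμ
            have hp : 0 ≤ π * frameDiag η' b μ := (mul_pos Real.pi_pos (hpos μ)).le
            exact mul_le_mul_of_nonneg_left (le_mul_of_one_le_right hp h1') hk'
        _ ≤ ∑ ν, (k ν)⁻¹ * (π * frameDiag η' b ν * α ν) :=
            Finset.single_le_sum (f := fun ν ↦ (k ν)⁻¹ * (π * frameDiag η' b ν * α ν)) (fun ν _ ↦ h1 ν)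
              (Finset.mem_univ μ)
  · refine ⟨1, one_pos, fun α hα ↦ absurd (funext fun ν ↦ ?_) hα⟩
    exact absurd ⟨ν, Finset.mem_univ ν⟩ hg

omit [Fintype ι] [FiniteDimensional ℂ U] in
/-- `λ_∅(0) = 0`: the vacuum is the kernel of `Δ_∅`. [cite: Lange2023AbelianVarietiesComplex, §1.6.2 Lemma 1.6.6] -/
theorem fockEigenvalue_empty_zero {η' : U [⋀^Fin 2]→L[ℝ] ℝ} {b : Fin g → U} :
    fockEigenvalue η' b k ∅ (0 : Fin g → ℕ) = 0 := by
  simp [fockEigenvalue_apply]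

omit [FiniteDimensional ℂ E] [FiniteDimensional ℂ U] in
/-- The Green data `G_∅ κ` of Fock data is Fock data (the vacuum mode is sent to `0`, the others divided by
`λ_∅(α) ≥ m > 0`). [cite: Lange2023AbelianVarietiesComplex, §1.6.1 Prop. 1.6.3] -/
theorem IsFockData.greenData_empty {Φ' : (ι → ℝ) ≃L[ℝ] U} {η' : U [⋀^Fin 2]→L[ℝ] ℝ} {b : Fin g → U}
    (hpos : ∀ ν, 0 < frameDiag η' b ν) (hk : ∀ ν, 0 < k ν) {κ' : (Fin g → ℕ) → U → ℂ}
    (hκ' : IsFockData Φ' η' χ b κ') : IsFockData Φ' η' χ b (ComplexTorus.greenData η' b k ∅ κ') := by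
  obtain ⟨m, hm, hmle⟩ := exists_pos_le_fockEigenvalue_empty hpos hk (η' := η') (b := b)
  refine hκ'.smul_fun (C := m⁻¹) (m := 0) fun α ↦ ?_
  rw [pow_zero, mul_one, Complex.norm_real, Real.norm_eq_abs,
    abs_of_nonneg (inv_nonneg.2 (fockEigenvalue_nonneg hpos hk ∅ α))]
  by_cases hα : α = 0
  · subst hα; rw [fockEigenvalue_empty_zero, inv_zero]; exact inv_nonneg.2 hm.le
  · exact inv_anti₀ hm (hmle α hα)

omit [Fintype ι] [FiniteDimensional ℂ U] in
/-- **`λ_∅ · G_∅ κ = κ - (vacuum part)`**: `λ_∅(α) G_∅ κ (α) = κ_α` for `α ≠ 0` and `= 0` for `α = 0`.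
[cite: Lange2023AbelianVarietiesComplex, §1.6.1 Prop. 1.6.3] -/
theorem fockEigenvalue_smul_greenData_empty {η' : U [⋀^Fin 2]→L[ℝ] ℝ} {b : Fin g → U}
    (hpos : ∀ ν, 0 < frameDiag η' b ν) (hk : ∀ ν, 0 < k ν) (κ' : (Fin g → ℕ) → U → ℂ) :
    (fun α ↦ ((fockEigenvalue η' b k ∅ α : ℝ) : ℂ) • greenData η' b k ∅ κ' α) =
      fun α ↦ if α = 0 then 0 else κ' α := by
  obtain ⟨m, hm, hmle⟩ := exists_pos_le_fockEigenvalue_empty hpos hk (η' := η') (b := b)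
  funext α
  by_cases hα : α = 0
  · subst hα; rw [if_pos rfl, fockEigenvalue_empty_zero]; simp
  · have hne : (fockEigenvalue η' b k ∅ α : ℂ) ≠ 0 := by exact_mod_cast (lt_of_lt_of_le hm (hmle α hα)).ne'
    rw [if_neg hα, greenData_apply, smul_smul, Complex.ofReal_inv, mul_inv_cancel₀ hne, one_smul]

omit [FiniteDimensional ℂ E] [FiniteDimensional ℂ U] in
/-- **The vacuum datum**: data supported at `α = 0` with value `θ ∈ H⁰` is Fock data.
[cite: Folland1989, §1.7 (vii)] -/
theorem IsFockData.vacuum {Φ' : (ι → ℝ) ≃L[ℝ] U} {η' : U [⋀^Fin 2]→L[ℝ] ℝ} {b : Fin g → U} {θ : U → ℂ}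
    (hθ : θ ∈ thetaFunctions Φ' (canonicalFactor Φ' η' χ)) :
    IsFockData Φ' η' χ b (fun α ↦ if α = 0 then θ else 0) := by
  classical
  refine ⟨fun α ↦ ?_, fun n ↦ ?_⟩
  · by_cases hα : α = 0
    · rw [if_pos hα]; exact hθ
    · rw [if_neg hα]; exact zero_mem _
  · refine summable_of_ne_finset_zero (s := {0}) fun α hα ↦ ?_
    rw [Finset.mem_singleton] at hα
    rw [fockWt_apply, if_neg hα, ahNorm_zero, mul_zero, mul_zero]

omit [Fintype ι] [FiniteDimensional ℂ U] in
/-- The Fock series of the vacuum datum `θ` is `θ` (`δ̄^0 = 1`). [cite: Folland1989, §1.7 (vii)] -/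
theorem fockSeries_vacuum {η' : U [⋀^Fin 2]→L[ℝ] ℝ} {b : Fin g → U} (h11 : ∀ u v : U, η' ![I • u, I • v] = η' ![u, v])
    (θ : U → ℂ) : fockSeries η' b (fun α ↦ if α = 0 then θ else 0) = θ := by
  classical
  funext v
  rw [fockSeries_apply, tsum_eq_single 0]
  · rw [if_pos rfl, fockOp_zero]
  · intro α hα
    rw [if_neg hα, fockOp_zero_fun h11, Pi.zero_apply]

variable (hη : IsNSForm Φ η) (hχ : IsSemicharacter Φ η χ)
  (horth : ∀ k l, hermOf η (w k) (w l) = if k = l then (c k : ℂ) else 0)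
  (hκ : ∀ v, κ (twistJ w N v) = I • κ v) (hcS : ∀ ν ∉ N, 0 < c ν) (hcN : ∀ ν ∈ N, c ν < 0) (hk : ∀ ν, 0 < k ν)
include hη horth hκ hcS hcN

omit [Fintype ι] [FiniteDimensional ℂ E] [FiniteDimensional ℂ U] hcS hcN in
/-- `H̃`-orthogonality of the basis `κ e_ν`, in the form the Fock files use. [cite: Lange2023AbelianVarietiesComplex, §1.6.3 Prop. 1.6.10] -/
theorem twistBasis_orthogonal : ∀ μ ν, μ ≠ ν → hermOf (twistForm η κ) (twistBasis hκ μ) (twistBasis hκ ν) = 0 := by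
  intro μ ν h
  rw [twistBasis_apply, twistBasis_apply]
  exact hermOf_twistForm_basis_basis_of_ne horth hη.type_one_one hκ μ ν h

omit [Fintype ι] [FiniteDimensional ℂ E] [FiniteDimensional ℂ U] in
/-- Positivity of the `H̃`-diagonal of `κ e_ν`, in the form the Fock files use. [cite: Lange2023AbelianVarietiesComplex, §1.6.3 Prop. 1.6.10] -/
theorem twistBasis_frameDiag_pos : ∀ ν, 0 < frameDiag (twistForm η κ) (⇑(twistBasis hκ)) ν := by
  intro ν
  rw [coe_twistBasis]
  exact frameDiag_twistForm_pos horth hη.type_one_one hκ hcS hcN ν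

omit [Fintype ι] [FiniteDimensional ℂ E] [FiniteDimensional ℂ U] hcS hcN in
/-- **The eigenvalue dictionary**: the multiplier of `Δ^L_I` on transported Fock data is `λ^M_{I ∆ N}`:
`Σ_ν k_ν^{-1} π h̃_ν (α_ν + [ν ∈ N]) + π Σ_{ν ∈ I} k_ν^{-1} c_ν = λ^M_{I ∆ N}(α)` (`h̃_ν = |c_ν|`).
[cite: Lange2023AbelianVarietiesComplex, §1.6.3 Prop. 1.6.10] -/
theorem fockEigenvalue_symmDiff (I : Finset (Fin g)) (α : Fin g → ℕ) :
    ∑ ν, (k ν)⁻¹ * (π * frameDiag (twistForm η κ) (⇑(twistBasis hκ)) ν * ((α ν : ℝ) + if ν ∈ N then 1 else 0)) +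
        π * ∑ ν ∈ I, (k ν)⁻¹ * c ν =
      fockEigenvalue (twistForm η κ) (⇑(twistBasis hκ)) k (symmDiff I N) α := by
  classical
  have hdiag : ∀ ν, frameDiag (twistForm η κ) (⇑(twistBasis hκ)) ν = if ν ∈ N then -c ν else c ν := fun ν ↦ by
    rw [coe_twistBasis]; exact frameDiag_twistForm horth hη.type_one_one hκ ν
  have hsum : ∀ (s : Finset (Fin g)) (f : Fin g → ℝ), ∑ ν ∈ s, f ν = ∑ ν, if ν ∈ s then f ν else 0 := fun s f ↦ by
    rw [Finset.sum_ite_mem, Finset.univ_inter]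
  rw [fockEigenvalue_apply, hsum I, hsum (symmDiff I N), Finset.mul_sum, Finset.mul_sum, ← Finset.sum_add_distrib,
    ← Finset.sum_add_distrib]
  refine Finset.sum_congr rfl fun ν _ ↦ ?_
  rw [hdiag ν]
  by_cases hI : ν ∈ I <;> by_cases hN : ν ∈ N <;> simp [hI, hN, Finset.mem_symmDiff] <;> ring

end MixedFock

/-! ## §3 `Δ^L_I`, `∂̄^L` on transported Fock series; the mixed Fock expansion of `A^{0,0}(L)` -/

section Transported

variable {ι : Type*} [Fintype ι] {E : Type*} [NormedAddCommGroup E] [NormedSpace ℂ E] [FiniteDimensional ℂ E]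
  {U : Type*} [NormedAddCommGroup U] [NormedSpace ℂ U] [FiniteDimensional ℂ U] {g : ℕ}
  {η : E [⋀^Fin 2]→L[ℝ] ℝ} {w : Module.Basis (Fin g) ℂ E} {c : Fin g → ℝ} {N : Finset (Fin g)} {κ : E ≃L[ℝ] U}
  {Φ : (ι → ℝ) ≃L[ℝ] E} {χ : (ι → ℤ) → ℂ} {k : Fin g → ℝ}

omit [Fintype ι] [FiniteDimensional ℂ E] [FiniteDimensional ℂ U] in
/-- `δ̄_v (-u) = -δ̄_v u` (function level). [cite: Lange2023AbelianVarietiesComplex, §1.6.1 Lemma 1.6.2] -/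
private theorem deltaBar_neg_fun (v : E) (u : E → ℂ) : deltaBar η v (-u) = -deltaBar η v u := by
  funext x
  have h1 : delAlong v (fun y ↦ -u y) x = -delAlong v u x := by
    simp only [delAlong_apply, fderiv_fun_neg, _root_.neg_apply]
    ring
  rw [show (-u) = fun y ↦ -u y from rfl, Pi.neg_apply, deltaBar_apply, deltaBar_apply, h1]
  ring

omit [Fintype ι] [FiniteDimensional ℂ E] [FiniteDimensional ℂ U] in
/-- The shifted number-operator weights `π h_ν (α_ν + ε)`, `ε ∈ {0,1}`, are polynomially bounded.
[cite: Folland1989, §1.7 (1.82)] -/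
theorem norm_numberWeight_shift_le {η' : U [⋀^Fin 2]→L[ℝ] ℝ} {b : Fin g → U} (hpos : ∀ ν, 0 < frameDiag η' b ν)
    (ν : Fin g) (P : Prop) [Decidable P] (α : Fin g → ℕ) :
    ‖(((π * frameDiag η' b ν * ((α ν : ℝ) + if P then 1 else 0) : ℝ)) : ℂ)‖ ≤
      (π * frameDiag η' b ν) * ((((∑ i, α i : ℕ) : ℝ)) + 1) ^ 1 := by
  have hh : 0 < π * frameDiag η' b ν := mul_pos Real.pi_pos (hpos ν)
  have hε : (0 : ℝ) ≤ (if P then 1 else 0) ∧ (if P then (1 : ℝ) else 0) ≤ 1 := by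
    split_ifs <;> simp
  rw [Complex.norm_real, Real.norm_eq_abs, abs_of_nonneg (by nlinarith [hε.1]), pow_one]
  refine mul_le_mul_of_nonneg_left ?_ hh.le
  have h1 : (α ν : ℝ) ≤ (∑ i, α i : ℕ) := by
    exact_mod_cast Finset.single_le_sum (f := α) (fun j _ ↦ Nat.zero_le _) (Finset.mem_univ ν)
  linarith [hε.2]

variable (hη : IsNSForm Φ η) (hχ : IsSemicharacter Φ η χ)
  (horth : ∀ k l, hermOf η (w k) (w l) = if k = l then (c k : ℂ) else 0)
  (hκ : ∀ v, κ (twistJ w N v) = I • κ v) (hcS : ∀ ν ∉ N, 0 < c ν) (hcN : ∀ ν ∈ N, c ν < 0) (hk : ∀ ν, 0 < k ν)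
include hη hχ horth hκ hcS hcN

/-- **Transported Fock series are smooth sections of `L`**: `T⁻¹(Σ_α δ̄_M^α κ̃_α) ∈ A^{0,0}(L)` for rapidly
decreasing `H⁰(Y, M)`-valued data `κ̃`. [cite: Lange2023AbelianVarietiesComplex, §1.6.3 Prop. 1.6.10] -/
theorem untwistFun_fockSeries_mem_smoothTheta {κ' : (Fin g → ℕ) → U → ℂ}
    (hκ' : IsFockData (Φ.trans κ) (twistForm η κ) χ (twistBasis hκ) κ') :
    untwistFun η w N κ (fockSeries (twistForm η κ) (twistBasis hκ) κ') ∈ smoothTheta Φ (canonicalFactor Φ η χ) :=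
  untwistFun_mem_smoothTheta horth hη.type_one_one hκ
    (hκ'.fockSeries_mem_smoothTheta (isNSForm_twistForm horth hη.type_one_one hκ hη)
      (isSemicharacter_twistForm (κ := κ) hχ) (twistBasis_orthogonal hη horth hκ)
      (twistBasis_frameDiag_pos hη horth hκ hcS hcN))

/-- **`Δ^L_I` is diagonal on transported Fock data with eigenvalues `λ^M_{I ∆ N}(α)`**:
`Δ^L_I T⁻¹(Σ_α δ̄_M^α κ̃_α) = T⁻¹(Σ_α λ^M_{I ∆ N}(α) δ̄_M^α κ̃_α)` (the letters of `L` in the directions `e_ν`,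
`ν ∈ N`, are minus the opposite letters of `M`, so `δ̄^L_ν ∂̄^L_ν = T⁻¹ ∂̄^M_ν δ̄^M_ν T` contributes
`π h̃_ν (α_ν + 1)` and the curvature term `π k_ν^{-1} c_ν = -π k_ν^{-1} h̃_ν`).
[cite: Lange2023AbelianVarietiesComplex, §1.6.3 Prop. 1.6.10] [cite: Lange2023AbelianVarietiesComplex, §1.6.1 Prop. 1.6.3] -/
theorem laplaceI_untwistFun_fockSeries {κ' : (Fin g → ℕ) → U → ℂ}
    (hκ' : IsFockData (Φ.trans κ) (twistForm η κ) χ (twistBasis hκ) κ') (I : Finset (Fin g)) :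
    laplaceI η (⇑w) k I (untwistFun η w N κ (fockSeries (twistForm η κ) (twistBasis hκ) κ')) =
      untwistFun η w N κ (fockSeries (twistForm η κ) (twistBasis hκ)
        (fun α ↦ ((fockEigenvalue (twistForm η κ) (⇑(twistBasis hκ)) k (symmDiff I N) α : ℝ) : ℂ) • κ' α)) := by
  classical
  have h11 := hη.type_one_one
  have hη' := isNSForm_twistForm horth h11 hκ hη
  have hχ' := isSemicharacter_twistForm (κ := κ) hχ
  have hb' := twistBasis_orthogonal hη horth hκ
  have hpos' := twistBasis_frameDiag_pos hη horth hκ hcS hcN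
  have h11' := hη'.type_one_one
  have hspan : ∀ u, u ∈ Submodule.span ℂ (Set.range (twistBasis hκ)) := fun u ↦ (twistBasis hκ).mem_span u
  set η' := twistForm η κ with hη'def
  set bB := twistBasis hκ with hbB
  set S := fockSeries η' bB κ' with hS
  have hSs : ContDiff ℝ ∞ S := hκ'.contDiff_fockSeries hη' hχ' hb' hpos'
  have hSd : Differentiable ℝ S := hSs.differentiable (by simp)
  have hbν : ∀ ν, bB ν = κ (w ν) := fun ν ↦ twistBasis_apply hκ ν
  -- the second-order terms, direction by direction
  have hd : ∀ ν, IsFockData (Φ.trans κ) η' χ bB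
      (fun α ↦ (((π * frameDiag η' bB ν * ((α ν : ℝ) + if ν ∈ N then 1 else 0) : ℝ)) : ℂ) • κ' α) := fun ν ↦
    hκ'.smul_fun (norm_numberWeight_shift_le hpos' ν (ν ∈ N))
  have hterm : ∀ ν, deltaBar η (w ν) (dbarAlong (w ν) (untwistFun η w N κ S)) =
      untwistFun η w N κ (fockSeries η' bB
        (fun α ↦ (((π * frameDiag η' bB ν * ((α ν : ℝ) + if ν ∈ N then 1 else 0) : ℝ)) : ℂ) • κ' α)) := by
    intro ν
    by_cases hν : ν ∈ N
    · have hψd : Differentiable ℝ (deltaBar η' (κ (w ν)) S) :=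
        (contDiff_deltaBar h11' hSs _).differentiable (by simp)
      rw [dbarAlong_untwistFun_of_mem horth h11 hκ hSd hν, deltaBar_neg_fun,
        deltaBar_untwistFun_of_mem horth h11 hκ hψd hν, neg_neg]
      have h := hκ'.dbarAlong_deltaBar_basis_fockSeries hη' hχ' hb' hpos' ν
      rw [hbν] at h
      rw [h]
      simp_rw [if_pos hν]
    · have hψd : Differentiable ℝ (dbarAlong (κ (w ν)) S) := (contDiff_dbarAlong hSs _).differentiable (by simp)
      rw [dbarAlong_untwistFun_of_notMem hκ hSd hν, deltaBar_untwistFun_of_notMem horth h11 hκ hψd hν]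
      have h := hκ'.deltaBar_dbarAlong_basis_fockSeries hη' hχ' hb' hpos' ν
      rw [hbν] at h
      rw [h]
      simp_rw [if_neg hν, add_zero]
  -- the data on the right as a combination
  set cI : ℂ := ((π * ∑ ν ∈ I, (k ν)⁻¹ * c ν : ℝ) : ℂ) with hcI
  have hdata : (fun α ↦ ((fockEigenvalue η' (⇑bB) k (symmDiff I N) α : ℝ) : ℂ) • κ' α) =
      ∑ ν, (((k ν)⁻¹ : ℝ) : ℂ) •
        (fun α ↦ (((π * frameDiag η' bB ν * ((α ν : ℝ) + if ν ∈ N then 1 else 0) : ℝ)) : ℂ) • κ' α) + cI • κ' := by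
    funext α
    simp only [Pi.add_apply, Finset.sum_apply, Pi.smul_apply, smul_smul, ← Finset.sum_smul, ← add_smul]
    congr 1
    rw [← fockEigenvalue_symmDiff hη horth hκ I α, hcI]
    push_cast
    rw [Finset.mul_sum]
  rw [hdata, IsFockData.fockSeries_add hη' hχ' hb' hpos' hspan (IsFockData.finset_sum_smul hη' hχ' _ _ hd) (hκ'.smul cI),
    IsFockData.fockSeries_finset_sum_smul hη' hχ' hb' hpos' hspan _ _ hd, fockSeries_smul h11' cI hκ'.contDiff,
    untwistFun_add, untwistFun_finset_sum, untwistFun_smul]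
  funext x
  rw [laplaceI_apply, Pi.add_apply, Finset.sum_apply, Pi.smul_apply, smul_eq_mul]
  congr 1
  · refine Finset.sum_congr rfl fun ν _ ↦ ?_
    rw [hterm ν, untwistFun_smul, Pi.smul_apply, smul_eq_mul]
  · rw [hcI]
    have hc : ∀ ν, hermOf η (w ν) (w ν) = c ν := fun ν ↦ by rw [horth, if_pos rfl]
    simp only [hc]
    push_cast
    rw [Finset.mul_sum]

/-- **The mixed Fock expansion of `A^{0,0}(L)`**: for non-degenerate `L = L(H, χ)` every smooth section is
`T⁻¹` of the Fock series of unique rapidly decreasing `H⁰(Y, M)`-valued data (the Fock expansion of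
`A^{0,0}(M)` on `Y`, row A2-92, pulled back along (1.31)). [cite: Lange2023AbelianVarietiesComplex, §1.6.3 Prop. 1.6.10] [cite: Folland1989, §1.7 (vii)] -/
theorem exists_isFockData_untwistFun_fockSeries_eq {φ : E → ℂ} (hφ : φ ∈ smoothTheta Φ (canonicalFactor Φ η χ)) :
    ∃ κ' : (Fin g → ℕ) → U → ℂ, IsFockData (Φ.trans κ) (twistForm η κ) χ (twistBasis hκ) κ' ∧
      untwistFun η w N κ (fockSeries (twistForm η κ) (twistBasis hκ) κ') = φ := by
  have h11 := hη.type_one_one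
  obtain ⟨κ', hκ', hS⟩ := (isRiemannForm_twistForm horth h11 hκ hη hcS hcN).exists_isFockData_fockSeries_eq
    (isSemicharacter_twistForm (κ := κ) hχ) (twistBasis hκ) (twistBasis_orthogonal hη horth hκ)
    (twistBasis_frameDiag_pos hη horth hκ hcS hcN) (twistFun_mem_smoothTheta horth h11 hκ hφ)
  exact ⟨κ', hκ', by rw [hS, untwistFun_twistFun]⟩

omit [FiniteDimensional ℂ E] in
/-- **Uniqueness of the transported Fock data.** [cite: Folland1989, §1.7 (vii)] -/
theorem eq_of_untwistFun_fockSeries_eq {κ₁ κ₂ : (Fin g → ℕ) → U → ℂ}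
    (h₁ : IsFockData (Φ.trans κ) (twistForm η κ) χ (twistBasis hκ) κ₁)
    (h₂ : IsFockData (Φ.trans κ) (twistForm η κ) χ (twistBasis hκ) κ₂)
    (heq : untwistFun η w N κ (fockSeries (twistForm η κ) (twistBasis hκ) κ₁) =
      untwistFun η w N κ (fockSeries (twistForm η κ) (twistBasis hκ) κ₂)) : κ₁ = κ₂ := by
  have h := congr_arg (twistFun η w N κ) heq
  rw [twistFun_untwistFun, twistFun_untwistFun] at h
  exact h₁.eq_of_fockSeries_eq (isNSForm_twistForm horth hη.type_one_one hκ hη) (isSemicharacter_twistForm (κ := κ) hχ)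
    (twistBasis_orthogonal hη horth hκ) (twistBasis_frameDiag_pos hη horth hκ hcS hcN) h₂ h

end Transported

/-! ## §4 The Hodge theorem for non-degenerate `L`: every `∂̄`-closed form is `∂̄`-cohomologous to its harmonic
part `T⁻¹(κ̃^N_0) dv̄_N`; `ℋ^q(L) → H^{0,q}_{∂̄}(X, L)` is bijective -/

section HodgeTheorem

variable {ι : Type*} [Fintype ι] {E : Type*} [NormedAddCommGroup E] [NormedSpace ℂ E] [FiniteDimensional ℂ E]
  {U : Type*} [NormedAddCommGroup U] [NormedSpace ℂ U] [FiniteDimensional ℂ U] {g : ℕ}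
  {η : E [⋀^Fin 2]→L[ℝ] ℝ} {w : Module.Basis (Fin g) ℂ E} {c : Fin g → ℝ} {N : Finset (Fin g)} {κ : E ≃L[ℝ] U}
  {Φ : (ι → ℝ) ≃L[ℝ] E} {χ : (ι → ℤ) → ℂ} {k : Fin g → ℝ}

omit [Fintype ι] [FiniteDimensional ℂ E] [FiniteDimensional ℂ U] in
/-- Index bookkeeping, `ν ∉ N`: `(J ∖ ν) ∆ N = (J ∆ N) ∖ ν` and `ν ∈ J ∆ N` for `ν ∈ J`. [folklore] -/
private theorem symmDiff_erase_of_notMem {J : Finset (Fin g)} {ν : Fin g} (hνJ : ν ∈ J) (hνN : ν ∉ N) :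
    symmDiff (J.erase ν) N = (symmDiff J N).erase ν ∧ ν ∈ symmDiff J N := by
  constructor
  · ext μ
    simp only [Finset.mem_symmDiff, Finset.mem_erase]
    by_cases h : μ = ν
    · subst h; tauto
    · tauto
  · rw [Finset.mem_symmDiff]; exact Or.inl ⟨hνJ, hνN⟩

omit [Fintype ι] [FiniteDimensional ℂ E] [FiniteDimensional ℂ U] in
/-- Index bookkeeping, `ν ∈ N`: `(J ∖ ν) ∆ N = (J ∆ N) ∪ {ν}` and `ν ∉ J ∆ N` for `ν ∈ J`. [folklore] -/
private theorem symmDiff_erase_of_mem {J : Finset (Fin g)} {ν : Fin g} (hνJ : ν ∈ J) (hνN : ν ∈ N) :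
    symmDiff (J.erase ν) N = insert ν (symmDiff J N) ∧ ν ∉ symmDiff J N := by
  constructor
  · ext μ
    simp only [Finset.mem_symmDiff, Finset.mem_erase, Finset.mem_insert]
    by_cases h : μ = ν
    · subst h; tauto
    · tauto
  · rw [Finset.mem_symmDiff]; tauto

omit [Fintype ι] [FiniteDimensional ℂ E] [FiniteDimensional ℂ U] in
/-- `IsHomogeneous` is stable under subtraction. [cite: Lange2023AbelianVarietiesComplex, §1.6.1 p0064] -/
private theorem IsHomogeneous.sub' {F : Type*} {q : ℕ} {σ τ : Finset (Fin g) → F → ℂ} (hσ : IsHomogeneous q σ)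
    (hτ : IsHomogeneous q τ) : IsHomogeneous q (σ - τ) := fun I hI ↦ by
  rw [Pi.sub_apply, hσ I hI, hτ I hI, sub_zero]

variable (hη : IsNSForm Φ η) (hχ : IsSemicharacter Φ η χ)
  (horth : ∀ k l, hermOf η (w k) (w l) = if k = l then (c k : ℂ) else 0)
  (hκ : ∀ v, κ (twistJ w N v) = I • κ v) (hcS : ∀ ν ∉ N, 0 < c ν) (hcN : ∀ ν ∈ N, c ν < 0) (hk : ∀ ν, 0 < k ν)
include hη hχ horth hκ hcS hcN hk

omit hk in
/-- **The data-level letter of `∂̄^L_{e_ν}`**: on transported Fock data `∂̄^L_{e_ν}` acts by the annihilation shift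
`A_ν` for `ν ∉ N` and by MINUS the creation shift `-S_ν` for `ν ∈ N`.
[cite: Lange2023AbelianVarietiesComplex, §1.6.3 Prop. 1.6.10] -/
theorem dbarAlong_untwistFun_fockSeries {κ' : (Fin g → ℕ) → U → ℂ}
    (hκ' : IsFockData (Φ.trans κ) (twistForm η κ) χ (twistBasis hκ) κ') (ν : Fin g) :
    dbarAlong (w ν) (untwistFun η w N κ (fockSeries (twistForm η κ) (twistBasis hκ) κ')) =
      untwistFun η w N κ (fockSeries (twistForm η κ) (twistBasis hκ)
        (if ν ∈ N then -ComplexTorus.creShift ν κ'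
         else ComplexTorus.annData (twistForm η κ) (twistBasis hκ) ν κ')) := by
  have h11 := hη.type_one_one
  have hη' := isNSForm_twistForm horth h11 hκ hη
  have hχ' := isSemicharacter_twistForm (κ := κ) hχ
  have hb' := twistBasis_orthogonal hη horth hκ
  have hpos' := twistBasis_frameDiag_pos hη horth hκ hcS hcN
  have hSd : Differentiable ℝ (fockSeries (twistForm η κ) (twistBasis hκ) κ') :=
    (hκ'.contDiff_fockSeries hη' hχ' hb' hpos').differentiable (by simp)
  by_cases hν : ν ∈ N
  · rw [if_pos hν, dbarAlong_untwistFun_of_mem horth h11 hκ hSd hν, ← twistBasis_apply hκ ν,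
      hκ'.deltaBar_basis_fockSeries hη' hχ' hb' hpos' ν, ← untwistFun_neg, ← neg_one_smul ℂ (ComplexTorus.creShift ν κ'),
      fockSeries_smul hη'.type_one_one _ (hκ'.creShift hpos' ν).contDiff, neg_one_smul]
  · rw [if_neg hν, dbarAlong_untwistFun_of_notMem hκ hSd hν, ← twistBasis_apply hκ ν,
      hκ'.dbarAlong_basis_fockSeries hη' hχ' hb' hpos' ν]

omit [FiniteDimensional ℂ E] [FiniteDimensional ℂ U] hχ hk in
/-- The data-level letter of `∂̄^L_{e_ν}` preserves Fock data. [cite: Folland1989, §1.7 (1.82)] -/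
theorem isFockData_twistLetter {κ' : (Fin g → ℕ) → U → ℂ}
    (hκ' : IsFockData (Φ.trans κ) (twistForm η κ) χ (twistBasis hκ) κ') (ν : Fin g) :
    IsFockData (Φ.trans κ) (twistForm η κ) χ (twistBasis hκ)
      (if ν ∈ N then -ComplexTorus.creShift ν κ' else ComplexTorus.annData (twistForm η κ) (twistBasis hκ) ν κ') := by
  have hpos' := twistBasis_frameDiag_pos hη horth hκ hcS hcN
  split_ifs
  · rw [← neg_one_smul ℂ (ComplexTorus.creShift ν κ')]; exact (hκ'.creShift hpos' ν).smul _
  · exact hκ'.annData hpos' ν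

omit [FiniteDimensional ℂ E] [FiniteDimensional ℂ U] hη hχ horth hcS hcN hk in
/-- **`∂̄ G = G ∂̄` on transported data**: the data-level letter of `∂̄^L_{e_ν}` intertwines the Green data
`G_{(J∖ν) ∆ N}` and `G_{J ∆ N}` (`ν ∈ J`; the two key identities `λ_{J'∖ν}(β + 1_ν) = λ_{J'}(β)` and
`λ_{J' ∪ ν}(β - 1_ν) = λ_{J'}(β)`). [cite: Lange2023AbelianVarietiesComplex, §1.6.1 Prop. 1.6.3] -/
theorem twistLetter_greenData_erase {J : Finset (Fin g)} {ν : Fin g} (hν : ν ∈ J) (κ' : (Fin g → ℕ) → U → ℂ) :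
    (if ν ∈ N then -ComplexTorus.creShift ν (greenData (twistForm η κ) (⇑(twistBasis hκ)) k (symmDiff (J.erase ν) N) κ')
      else ComplexTorus.annData (twistForm η κ) (twistBasis hκ) ν
        (greenData (twistForm η κ) (⇑(twistBasis hκ)) k (symmDiff (J.erase ν) N) κ')) =
      greenData (twistForm η κ) (⇑(twistBasis hκ)) k (symmDiff J N)
        (if ν ∈ N then -ComplexTorus.creShift ν κ' else ComplexTorus.annData (twistForm η κ) (twistBasis hκ) ν κ') := by
  by_cases hνN : ν ∈ N
  · obtain ⟨h1, h2⟩ := symmDiff_erase_of_mem (N := N) hν hνN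
    rw [if_pos hνN, if_pos hνN, h1, creShift_greenData_insert h2]
    funext β
    rw [Pi.neg_apply, greenData_apply, greenData_apply, Pi.neg_apply, smul_neg]
  · obtain ⟨h1, h2⟩ := symmDiff_erase_of_notMem (N := N) hν hνN
    rw [if_neg hνN, if_neg hνN, h1, annData_greenData_erase h2]

/-- **Theorem (the Hodge theorem for a non-degenerate line bundle on a complex torus, via the Fock expansion).**
Let `L = L(H, χ)` with `H` non-degenerate, `e` an `H`-orthogonal basis with `H(e_ν, e_ν) = c_ν ≠ 0`, `N = {c_ν < 0}`
(`s = #N` the index), `k_ν > 0`.  Then every `∂̄`-closed `σ ∈ A^{0,q}(L)` differs from a HARMONIC form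
`h ∈ ℋ^q(L)` by a `∂̄`-exact one: `σ - h ∈ B^{0,q}_{∂̄}`.  Proof (q ≥ 1; q = 0 is `Z^{0,0} = ℋ^0`): expand
`σ_I = T⁻¹ Σ_α δ̄_M^α κ̃^I_α` on `Y` (Prop. 1.6.10 transport + the Fock expansion of `A^{0,0}(M)`); put
`τ_I = T⁻¹ Σ_α δ̄_M^α (κ̃^I_α / λ_{I∆N}(α))` (the vacuum mode `(I, α) = (N, 0)`, where `λ = 0`, dropped) and
`h = T⁻¹(κ̃^N_0) dv̄_N ∈ ℋ^q(L)`; then `Δτ = σ - h` (`Δ^L_I ↔ λ^M_{I∆N}`), `∂̄τ = 0` (`∂̄ G = G ∂̄` and uniqueness of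
Fock data applied to `∂̄σ = 0`), so `σ - h = ∂̄δ̄τ + δ̄∂̄τ = ∂̄(δ̄τ)`.
[cite: Lange2023AbelianVarietiesComplex, §1.6.1 Thm. 1.6.1] [cite: Lange2023AbelianVarietiesComplex, §1.6.3 Prop. 1.6.10] -/
theorem IsNSForm.exists_harmonic_sub_mem_dbarExactForms {q : ℕ} {σ : Finset (Fin g) → E → ℂ}
    (hσ : σ ∈ dbarClosedForms Φ η χ (⇑w) q) :
    ∃ h ∈ hη.harmonicForms (⇑w) k χ q, σ - h ∈ dbarExactForms Φ η χ (⇑w) q := by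
  classical
  have hb : ∀ μ ν, μ ≠ ν → hermOf η (w μ) (w ν) = 0 := hermOf_basis_eq_zero_of_ne horth
  -- degree 0: `Z^{0,0} = ℋ^0`
  rcases Nat.eq_zero_or_pos q with rfl | hq
  · refine ⟨σ, ?_, by rw [sub_self]; exact zero_mem _⟩
    rw [← hη.dbarClosedForms_zero_eq_harmonicForms_zero hχ hb hk]; exact hσ
  obtain ⟨hσA, hσq, hσ0⟩ := hσ
  have h11 := hη.type_one_one
  have hη' := isNSForm_twistForm horth h11 hκ hη
  have hχ' := isSemicharacter_twistForm (κ := κ) hχ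
  have hb' := twistBasis_orthogonal hη horth hκ
  have hpos' := twistBasis_frameDiag_pos hη horth hκ hcS hcN
  have h11' := hη'.type_one_one
  have hspan : ∀ u, u ∈ Submodule.span ℂ (Set.range (twistBasis hκ)) := fun u ↦ (twistBasis hκ).mem_span u
  set η' := twistForm η κ with hη'def
  set bB := twistBasis hκ with hbB
  have hσI : ∀ I, σ I ∈ smoothTheta Φ (canonicalFactor Φ η χ) := mem_formSpace_iff.1 hσA
  -- transported Fock data of the coefficients (zero data where the coefficient vanishes)
  have hex : ∀ I : Finset (Fin g), ∃ κ' : (Fin g → ℕ) → U → ℂ, IsFockData (Φ.trans κ) η' χ bB κ' ∧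
      untwistFun η w N κ (fockSeries η' bB κ') = σ I ∧ (σ I = 0 → κ' = 0) := by
    intro I
    by_cases h0 : σ I = 0
    · exact ⟨0, IsFockData.zero, by rw [h0, fockSeries_zero h11', untwistFun_zero], fun _ ↦ rfl⟩
    · obtain ⟨κ', hκ', hS⟩ := exists_isFockData_untwistFun_fockSeries_eq hη hχ horth hκ hcS hcN (hσI I)
      exact ⟨κ', hκ', hS, fun h ↦ absurd h h0⟩
  choose κI hκI hκS hκ0 using hex
  -- Green data with index set `I ∆ N`
  set G : Finset (Fin g) → (Fin g → ℕ) → U → ℂ := fun I ↦ greenData η' (⇑bB) k (symmDiff I N) (κI I) with hG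
  have hGdata : ∀ I, IsFockData (Φ.trans κ) η' χ bB (G I) := by
    intro I
    by_cases hI : (symmDiff I N).Nonempty
    · exact (hκI I).greenData hpos' hk hI
    · rw [Finset.not_nonempty_iff_eq_empty] at hI
      simp only [hG]; rw [hI]; exact (hκI I).greenData_empty hpos' hk
  set τ : Finset (Fin g) → E → ℂ := fun I ↦ untwistFun η w N κ (fockSeries η' bB (G I)) with hτ
  have hτA : τ ∈ formSpace Φ (canonicalFactor Φ η χ) g :=
    mem_formSpace_iff.2 fun I ↦ untwistFun_fockSeries_mem_smoothTheta hη hχ horth hκ hcS hcN (hGdata I)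
  have hτsm : ∀ J, ContDiff ℝ ∞ (τ J) := fun J ↦ (mem_formSpace_iff.1 hτA J).1
  have hτq : IsHomogeneous q τ := by
    intro I hI
    show untwistFun η w N κ (fockSeries η' bB (G I)) = 0
    simp only [hG]; rw [hκ0 I (hσq I hI), greenData_zero, fockSeries_zero h11', untwistFun_zero]
  -- the harmonic part: the vacuum coefficient at the index `N`
  set θ₀ : U → ℂ := κI N 0 with hθ₀
  have hθ₀m : θ₀ ∈ thetaFunctions (Φ.trans κ) (canonicalFactor (Φ.trans κ) η' χ) := (hκI N).mem 0
  have hfun : untwistFun η w N κ θ₀ ∈ hη.harmonicFun (⇑w) k χ N := untwistFun_mem_harmonicFun hη hχ horth hk hκ hθ₀m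
  set h : Finset (Fin g) → E → ℂ := Pi.single N (untwistFun η w N κ θ₀) with hh
  have hhN : h N = untwistFun η w N κ θ₀ := by simp [hh]
  have hhI : ∀ I, I ≠ N → h I = 0 := fun I hI ↦ by simp [hh, hI]
  have hhmem : h ∈ hη.harmonicForms (⇑w) k χ q := by
    by_cases hqN : N.card = q
    · have := hfun
      rw [IsNSForm.harmonicFun, Submodule.mem_comap, LinearMap.coe_single] at this
      rw [← hqN]; exact this
    · have h0 : θ₀ = 0 := by simp only [hθ₀]; rw [hκ0 N (hσq N hqN)]; rfl
      have : h = 0 := by rw [hh, h0, untwistFun_zero, Pi.single_zero]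
      rw [this]; exact zero_mem _
  have hhq : IsHomogeneous q h := (hη.mem_harmonicForms_iff.1 hhmem).2.1
  -- (a) `Δ τ = σ - h`
  have hΔ : laplaceForm η (⇑w) k τ = σ - h := by
    funext I x
    rw [laplaceForm_apply h11 hb hτsm I x]
    show laplaceI η (⇑w) k I (untwistFun η w N κ (fockSeries η' bB (G I))) x = (σ - h) I x
    rw [laplaceI_untwistFun_fockSeries hη hχ horth hκ hcS hcN (hGdata I) I]
    by_cases hI : (symmDiff I N).Nonempty
    · have hIN : I ≠ N := fun h ↦ by rw [h, symmDiff_self] at hI; exact Finset.not_nonempty_empty hI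
      simp only [hG]
      rw [fockEigenvalue_smul_greenData hpos' hk hI, hκS, Pi.sub_apply, hhI I hIN, sub_zero]
    · rw [Finset.not_nonempty_iff_eq_empty] at hI
      have hIN : I = N := symmDiff_eq_bot.1 hI
      subst hIN
      simp only [hG]
      rw [hI, fockEigenvalue_smul_greenData_empty hpos' hk]
      -- `κ = (κ - vacuum) + vacuum`
      have hsplit : (fun α ↦ if α = 0 then (0 : U → ℂ) else κI I α) = κI I - fun α ↦ if α = 0 then θ₀ else 0 := by
        funext α; by_cases hα : α = 0
        · subst hα; simp [hθ₀]
        · simp [hα]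
      have hvac : IsFockData (Φ.trans κ) η' χ bB (fun α ↦ if α = 0 then θ₀ else 0) := IsFockData.vacuum hθ₀m
      have hnv : IsFockData (Φ.trans κ) η' χ bB (fun α ↦ if α = 0 then (0 : U → ℂ) else κI I α) := by
        rw [hsplit, sub_eq_add_neg, ← neg_one_smul ℂ (fun α ↦ if α = 0 then θ₀ else (0 : U → ℂ))]
        exact (hκI I).add hη' hχ' (hvac.smul _)
      have hser : fockSeries η' bB (fun α ↦ if α = 0 then (0 : U → ℂ) else κI I α) =
          fockSeries η' bB (κI I) - θ₀ := by
        have hsum := IsFockData.fockSeries_add hη' hχ' hb' hpos' hspan hnv hvac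
        rw [fockSeries_vacuum h11'] at hsum
        rw [eq_sub_iff_add_eq, ← hsum, hsplit, sub_add_cancel]
      rw [hser, untwistFun_sub, hκS, Pi.sub_apply, Pi.sub_apply, hhN]
      rfl
  -- (b) `∂̄ τ = 0`
  have hdbar : dbarForm (⇑w) τ = 0 := by
    funext J
    -- data-level letters of `∂̄^L_{e_ν}`
    set L : Fin g → ((Fin g → ℕ) → U → ℂ) → (Fin g → ℕ) → U → ℂ := fun ν κ' ↦
      if ν ∈ N then -ComplexTorus.creShift ν κ' else ComplexTorus.annData η' bB ν κ' with hL
    have hLdata : ∀ ν {κ'}, IsFockData (Φ.trans κ) η' χ bB κ' → IsFockData (Φ.trans κ) η' χ bB (L ν κ') :=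
      fun ν κ' hκ' ↦ isFockData_twistLetter hη horth hκ hcS hcN hκ' ν
    have hLser : ∀ ν {κ'}, IsFockData (Φ.trans κ) η' χ bB κ' →
        dbarAlong (w ν) (untwistFun η w N κ (fockSeries η' bB κ')) = untwistFun η w N κ (fockSeries η' bB (L ν κ')) :=
      fun ν κ' hκ' ↦ dbarAlong_untwistFun_fockSeries hη hχ horth hκ hcS hcN hκ' ν
    -- the data `D` of `(∂̄σ)_J = 0`
    set D : (Fin g → ℕ) → U → ℂ := ∑ ν ∈ J, koszulSign ν (J.erase ν) • L ν (κI (J.erase ν)) with hD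
    have hDdata : IsFockData (Φ.trans κ) η' χ bB D :=
      IsFockData.finset_sum_smul hη' hχ' _ _ (fun ν ↦ hLdata ν (hκI (J.erase ν)))
    have hDS : untwistFun η w N κ (fockSeries η' bB D) = dbarForm (⇑w) σ J := by
      rw [hD, IsFockData.fockSeries_finset_sum_smul hη' hχ' hb' hpos' hspan _ _ (fun ν ↦ hLdata ν (hκI (J.erase ν))),
        untwistFun_finset_sum]
      funext y
      rw [Finset.sum_apply, dbarForm_apply]
      refine Finset.sum_congr rfl fun ν _ ↦ ?_
      rw [untwistFun_smul, Pi.smul_apply, smul_eq_mul, ← hLser ν (hκI (J.erase ν)), hκS]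
    have hD0 : D = 0 := by
      refine eq_of_untwistFun_fockSeries_eq hη hχ horth hκ hcS hcN hDdata IsFockData.zero ?_
      rw [hDS, fockSeries_zero h11', untwistFun_zero, hσ0]
      rfl
    -- `(∂̄τ)_J = T⁻¹ S(G_{J∆N} D) = 0`
    have hτJ : dbarForm (⇑w) τ J = untwistFun η w N κ (fockSeries η' bB (greenData η' (⇑bB) k (symmDiff J N) D)) := by
      have hsum : greenData η' (⇑bB) k (symmDiff J N) D =
          ∑ ν ∈ J, koszulSign ν (J.erase ν) • L ν (G (J.erase ν)) := by
        funext β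
        rw [greenData_apply, hD, Finset.sum_apply, Finset.sum_apply, Finset.smul_sum]
        refine Finset.sum_congr rfl fun ν hν ↦ ?_
        have hcomm := twistLetter_greenData_erase (η := η) (κ := κ) (k := k) (N := N) hκ hν (κI (J.erase ν))
        rw [Pi.smul_apply, Pi.smul_apply, smul_comm, ← greenData_apply]
        simp only [hL, hG]
        rw [← hcomm]
      rw [hsum, IsFockData.fockSeries_finset_sum_smul hη' hχ' hb' hpos' hspan _ _ (fun ν ↦ hLdata ν (hGdata (J.erase ν))),
        untwistFun_finset_sum]
      funext y
      rw [Finset.sum_apply, dbarForm_apply]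
      refine Finset.sum_congr rfl fun ν _ ↦ ?_
      rw [untwistFun_smul, Pi.smul_apply, smul_eq_mul, ← hLser ν (hGdata (J.erase ν))]
    rw [hτJ, hD0, greenData_zero, fockSeries_zero h11', untwistFun_zero]
    rfl
  -- (c) `σ - h = Δτ = ∂̄(δ̄τ)`
  have hexact : dbarForm (⇑w) (deltaForm η (⇑w) k τ) = σ - h := by
    have h' := hΔ
    rw [show laplaceForm η (⇑w) k τ = fun I x ↦ dbarForm (⇑w) (deltaForm η (⇑w) k τ) I x +
        deltaForm η (⇑w) k (dbarForm (⇑w) τ) I x from rfl, hdbar, deltaForm_zero] at h'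
    funext I x
    have := congr_fun (congr_fun h' I) x
    simpa using this
  have hq' : IsHomogeneous ((q - 1) + 1) τ := by rwa [Nat.sub_add_cancel hq]
  refine ⟨h, hhmem, hσq.sub' hhq, deltaForm η (⇑w) k τ, deltaForm_mem_formSpace (b := ⇑w) (η := η) (k := k) hη hτA,
    IsHomogeneous.deltaForm (b := ⇑w) (η := η) (k := k) hq', hexact⟩

/-- **Theorem 1.6.1 (Lange 2023) for a non-degenerate line bundle: `ℋ^q(L) → H^{0,q}_{∂̄}(X, L)`, `σ ↦ [σ]`, is
bijective in every degree** (injective: row A2-79; surjective: the previous theorem).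
[cite: Lange2023AbelianVarietiesComplex, §1.6.1 Thm. 1.6.1] [cite: HuybrechtsCG2005, §4.1 Cor. 4.1.14] -/
theorem IsNSForm.harmonicToDolbeault_bijective_of_nondegenerate (q : ℕ) :
    Function.Bijective (hη.harmonicToDolbeault (b := ⇑w) hχ (hermOf_basis_eq_zero_of_ne horth) hk (q := q)) := by
  have hb : ∀ μ ν, μ ≠ ν → hermOf η (w μ) (w ν) = 0 := hermOf_basis_eq_zero_of_ne horth
  refine ⟨hη.harmonicToDolbeault_injective hχ hb hk, fun cl ↦ ?_⟩
  induction cl using Submodule.Quotient.induction_on with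
  | H σ =>
    obtain ⟨h, hh, hsub⟩ := hη.exists_harmonic_sub_mem_dbarExactForms hχ horth hκ hcS hcN hk σ.2
    refine ⟨⟨h, hh⟩, ?_⟩
    rw [hη.harmonicToDolbeault_apply hχ hb hk]
    change dbarCohomology.mk Φ η χ (⇑w) q _ = dbarCohomology.mk Φ η χ (⇑w) q σ
    rw [dbarCohomology.mk_eq_mk_iff, Submodule.coe_inclusion]
    have : (h : Finset (Fin g) → E → ℂ) - σ = -(σ - h) := by abel
    rw [this]
    exact neg_mem hsub

end HodgeTheorem

/-! ## §5 The statements on `X` alone (`U = ℂ^g` with the coordinates (1.30)): Theorem 1.6.1 for non-degenerate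
`L`, `H^{0,q}_{∂̄}(X, L) ≅ ℋ^q(L)`, Mumford's index theorem `h^q(L) = 0` (`q ≠ s`), `h^s(L) = d_1 ⋯ d_g` -/

section IndexTheorem

variable {ι : Type*} [Fintype ι] {E : Type*} [NormedAddCommGroup E] [NormedSpace ℂ E] [FiniteDimensional ℂ E] {g : ℕ}
  {η : E [⋀^Fin 2]→L[ℝ] ℝ} {w : Module.Basis (Fin g) ℂ E} {c : Fin g → ℝ}
  {Φ : (ι → ℝ) ≃L[ℝ] E} {χ : (ι → ℤ) → ℂ} {k : Fin g → ℝ}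
  (hη : IsNSForm Φ η) (hχ : IsSemicharacter Φ η χ)
  (horth : ∀ k l, hermOf η (w k) (w l) = if k = l then (c k : ℂ) else 0) (hc : ∀ ν, c ν ≠ 0) (hk : ∀ ν, 0 < k ν)
include hη hχ horth hc hk

omit [FiniteDimensional ℂ E] hη hχ hk in
/-- For non-degenerate `H`, `c_ν > 0` off the negative directions. [cite: Lange2023AbelianVarietiesComplex, §1.6.3 (1.29)] -/
theorem pos_of_notMem_negDirs {ν : Fin g} (hν : ν ∉ negDirs η (⇑w)) : 0 < c ν := by
  rw [mem_negDirs_iff_lt horth] at hν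
  rcases lt_trichotomy (c ν) 0 with h | h | h
  · exact absurd h hν
  · exact absurd h (hc ν)
  · exact h

omit [FiniteDimensional ℂ E] hη hχ hc hk in
/-- `c_ν < 0` on the negative directions. [cite: Lange2023AbelianVarietiesComplex, §1.6.3 (1.29)] -/
theorem neg_of_mem_negDirs {ν : Fin g} (hν : ν ∈ negDirs η (⇑w)) : c ν < 0 :=
  (mem_negDirs_iff_lt horth ν).1 hν

/-- **Theorem 1.6.1 (Lange 2023) for a non-degenerate line bundle `L = L(H, χ)` on a complex torus:
`ℋ^q(L) → H^{0,q}_{∂̄}(X, L)` is bijective for every `q`** (any `H`-orthogonal complex basis with non-zero diagonal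
and positive Kähler weights; the auxiliary torus `Y = ℂ^g/Λ` of Prop. 1.6.10 with the coordinates (1.30) is used
inside the proof). [cite: Lange2023AbelianVarietiesComplex, §1.6.1 Thm. 1.6.1] [cite: Lange2023AbelianVarietiesComplex, §1.6.3 Prop. 1.6.10] -/
theorem IsNSForm.harmonicToDolbeault_bijective_of_ne_zero (q : ℕ) :
    Function.Bijective (hη.harmonicToDolbeault (b := ⇑w) hχ (hermOf_basis_eq_zero_of_ne horth) hk (q := q)) :=
  hη.harmonicToDolbeault_bijective_of_nondegenerate hχ horth (twistCoord_twistJ w (negDirs η (⇑w)))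
    (fun _ hν ↦ pos_of_notMem_negDirs horth hc hν) (fun _ hν ↦ neg_of_mem_negDirs horth hν) hk q

/-- **`ℋ^q(L) ≃ₗ[ℂ] H^{0,q}_{∂̄}(X, L)`** for non-degenerate `L`. [cite: Lange2023AbelianVarietiesComplex, §1.6.1 Thm. 1.6.1] -/
def IsNSForm.harmonicFormsEquivDbarCohomology (q : ℕ) :
    ↥(hη.harmonicForms (⇑w) k χ q) ≃ₗ[ℂ] dbarCohomology Φ η χ (⇑w) q :=
  LinearEquiv.ofBijective _ (hη.harmonicToDolbeault_bijective_of_ne_zero hχ horth hc hk q)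

/-- The equivalence is the class map `σ ↦ [σ]`. [cite: Lange2023AbelianVarietiesComplex, §1.6.1 Thm. 1.6.1] -/
theorem IsNSForm.harmonicFormsEquivDbarCohomology_apply (q : ℕ) (σ : ↥(hη.harmonicForms (⇑w) k χ q)) :
    hη.harmonicFormsEquivDbarCohomology hχ horth hc hk q σ =
      hη.harmonicToDolbeault (b := ⇑w) hχ (hermOf_basis_eq_zero_of_ne horth) hk σ :=
  rfl

/-- **`dim_ℂ H^{0,q}_{∂̄}(X, L) = dim_ℂ ℋ^q(L)`** for non-degenerate `L`. [cite: Lange2023AbelianVarietiesComplex, §1.6.1 Thm. 1.6.1] -/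
theorem IsNSForm.finrank_dbarCohomology_eq_finrank_harmonicForms (q : ℕ) :
    Module.finrank ℂ (dbarCohomology Φ η χ (⇑w) q) = Module.finrank ℂ ↥(hη.harmonicForms (⇑w) k χ q) :=
  ((hη.harmonicFormsEquivDbarCohomology hχ horth hc hk q).finrank_eq).symm

omit hk in
/-- **Mumford's index theorem, vanishing part (Lange Thm. 1.6.4 / Thm. 1.6.8 for non-degenerate `L`):
`H^{0,q}_{∂̄}(X, L) = 0` for `q ≠ s`**, `s = #negDirs` the index of `H` (every class is represented by a
harmonic form — Kähler weights `k_ν = 1` — and `ℋ^q(L) = 0` for `q ≠ s`, row A2-77). [cite: Lange2023AbelianVarietiesComplex, §1.6.2 Thm. 1.6.4] [cite: Lange2023AbelianVarietiesComplex, §1.6.3 Thm. 1.6.8] -/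
theorem IsNSForm.subsingleton_dbarCohomology_of_ne_index {q : ℕ} (hq : q ≠ (negDirs η (⇑w)).card) :
    Subsingleton (dbarCohomology Φ η χ (⇑w) q) := by
  have hb := hermOf_basis_eq_zero_of_ne horth
  have hk₁ : ∀ ν : Fin g, 0 < (fun _ ↦ (1 : ℝ)) ν := fun _ ↦ one_pos
  have hq' : g - (posDirs η (⇑w)).card < q ∨ q < (negDirs η (⇑w)).card := by
    have := (card_posDirs_add_card_negDirs_eq_iff horth).2 hc; omega
  refine ⟨fun x y ↦ ?_⟩
  obtain ⟨σ, rfl⟩ := (hη.harmonicToDolbeault_bijective_of_ne_zero hχ horth hc hk₁ q).2 x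
  obtain ⟨τ, rfl⟩ := (hη.harmonicToDolbeault_bijective_of_ne_zero hχ horth hc hk₁ q).2 y
  have hσ : σ = 0 := Subtype.ext (hη.eq_zero_of_mem_harmonicForms hχ hb hk₁ hq' σ.2)
  have hτ : τ = 0 := Subtype.ext (hη.eq_zero_of_mem_harmonicForms hχ hb hk₁ hq' τ.2)
  rw [hσ, hτ]

omit hk in
/-- **`h^q(L) = dim_ℂ H^{0,q}_{∂̄}(X, L) = 0` for `q ≠ s`** (non-degenerate `L` of index `s`).
[cite: Lange2023AbelianVarietiesComplex, §1.6.3 Thm. 1.6.8] -/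
theorem IsNSForm.finrank_dbarCohomology_eq_zero_of_ne_index {q : ℕ} (hq : q ≠ (negDirs η (⇑w)).card) :
    Module.finrank ℂ (dbarCohomology Φ η χ (⇑w) q) = 0 := by
  haveI := hη.subsingleton_dbarCohomology_of_ne_index hχ horth hc hq
  exact Module.finrank_zero_of_subsingleton

omit hk in
/-- **`rank_ℂ H^{0,q}_{∂̄}(X, L) = 0` for `q ≠ s`** (cardinal rank). [cite: Lange2023AbelianVarietiesComplex, §1.6.3 Thm. 1.6.8] -/
theorem IsNSForm.rank_dbarCohomology_eq_zero_of_ne_index {q : ℕ} (hq : q ≠ (negDirs η (⇑w)).card) :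
    Module.rank ℂ (dbarCohomology Φ η χ (⇑w) q) = 0 := by
  haveI := hη.subsingleton_dbarCohomology_of_ne_index hχ horth hc hq
  exact rank_subsingleton' ℂ _

omit hk in
/-- **Mumford's index theorem, the non-zero group: `h^s(L) = dim_ℂ H^{0,s}_{∂̄}(X, L) = d_1 ⋯ d_g = Pf(E)`** for
`L = L(H, χ)` non-degenerate of index `s = #negDirs` and type `(d_1, …, d_g)` (Thm. 1.6.8 with `g - r - s = 0`;
`hrad`: `L` trivial on the radical lattice vectors — void here, kept in the tree's form; Kähler weights `k_ν = 1`
inside the proof). [cite: Lange2023AbelianVarietiesComplex, §1.6.3 Thm. 1.6.8] [cite: Lange2023AbelianVarietiesComplex, §1.6.2 Thm. 1.6.4] -/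
theorem IsNSForm.finrank_dbarCohomology_index_eq_prod {d : Fin g → ℕ} (hd : IsPolarizationType Φ η d)
    (hdpos : ∀ i, 0 < d i) (hrad : ∀ n : ι → ℤ, (∀ v : E, η ![latticeVec Φ n, v] = 0) → χ n = 1) :
    Module.finrank ℂ (dbarCohomology Φ η χ (⇑w) (negDirs η (⇑w)).card) = ∏ i, d i := by
  have hk₁ : ∀ ν : Fin g, 0 < (fun _ ↦ (1 : ℝ)) ν := fun _ ↦ one_pos
  rw [hη.finrank_dbarCohomology_eq_finrank_harmonicForms hχ horth hc hk₁]
  exact hη.finrank_harmonicForms_index_eq_prod hχ horth hk₁ hc hd hdpos hrad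

omit hk in
/-- **The same with the index written as `hermIndex η`** (the tree's intrinsic index of `H`).
[cite: Lange2023AbelianVarietiesComplex, §1.6.3 Thm. 1.6.8] -/
theorem IsNSForm.finrank_dbarCohomology_hermIndex_eq_prod {d : Fin g → ℕ} (hd : IsPolarizationType Φ η d)
    (hdpos : ∀ i, 0 < d i) (hrad : ∀ n : ι → ℤ, (∀ v : E, η ![latticeVec Φ n, v] = 0) → χ n = 1) :
    Module.finrank ℂ (dbarCohomology Φ η χ (⇑w) (hermIndex η)) = ∏ i, d i := by
  have hk₁ : ∀ ν : Fin g, 0 < (fun _ ↦ (1 : ℝ)) ν := fun _ ↦ one_pos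
  rw [hη.finrank_dbarCohomology_eq_finrank_harmonicForms hχ horth hc hk₁]
  exact hη.finrank_harmonicForms_hermIndex_eq_prod hχ horth hk₁ hc hd hdpos hrad

end IndexTheorem

/-! ## §6 The Riemann–Roch theorem for non-degenerate `L` in the `∂̄`-cohomology:
`χ(L) = Σ_q (-1)^q h^q(L) = (-1)^s d_1 ⋯ d_g = (L^g)/g!` (Lange Thm. 1.7.1 / Thm. 1.7.3) -/

section RiemannRoch

variable {ι : Type*} [Fintype ι] {E : Type*} [NormedAddCommGroup E] [NormedSpace ℂ E] [FiniteDimensional ℂ E] {g : ℕ}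
  {η : E [⋀^Fin 2]→L[ℝ] ℝ} {w : Module.Basis (Fin g) ℂ E} {c : Fin g → ℝ}
  {Φ : (ι → ℝ) ≃L[ℝ] E} {χ : (ι → ℤ) → ℂ}
  (hη : IsNSForm Φ η) (hχ : IsSemicharacter Φ η χ)
  (horth : ∀ k l, hermOf η (w k) (w l) = if k = l then (c k : ℂ) else 0) (hc : ∀ ν, c ν ≠ 0)

omit [Fintype ι] [FiniteDimensional ℂ E] in
/-- For non-degenerate `E`, `χ` is trivial on the radical lattice vectors (there are none but `0`, and
`χ(0) = 1`). [cite: Lange2023AbelianVarietiesComplex, §1.3.1 (1.10)] -/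
theorem semichar_radical_eq_one_of_nondegenerate (hχ : IsSemicharacter Φ η χ)
    (hnd : ∀ v : E, v ≠ 0 → ∃ u : E, η ![v, u] ≠ 0) (n : ι → ℤ)
    (hrad : ∀ v : E, η ![latticeVec Φ n, v] = 0) : χ n = 1 := by
  have hn : latticeVec Φ n = 0 := by
    by_contra h
    obtain ⟨u, hu⟩ := hnd _ h
    exact hu (hrad u)
  have hn0 : n = 0 := latticeVec_injective Φ (by rw [hn, latticeVec_zero])
  subst hn0
  have h := hχ.map_add 0 0
  rw [add_zero, latticeVec_zero, twoForm_self, ofReal_zero, mul_zero, Complex.exp_zero, mul_one] at h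
  have h2 : χ 0 * χ 0 = χ 0 * 1 := by rw [mul_one]; exact h.symm
  exact mul_left_cancel₀ (hχ.ne_zero Φ 0) h2

include hη hχ horth hc

/-- **`h^q(L)` for non-degenerate `L` of type `(d_1, …, d_g)`: `dim_ℂ H^{0,q}_{∂̄}(X, L) = d_1 ⋯ d_g` if
`q = s = hermIndex H`, and `0` otherwise** (Thm. 1.6.8 with `r + s = g`; the positivity `d_i > 0` and the
radical condition are automatic for non-degenerate `H`). [cite: Lange2023AbelianVarietiesComplex, §1.6.3 Thm. 1.6.8] -/
theorem IsNSForm.finrank_dbarCohomology_eq_ite {d : Fin g → ℕ} (hd : IsPolarizationType Φ η d) (q : ℕ) :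
    Module.finrank ℂ (dbarCohomology Φ η χ (⇑w) q) = if q = hermIndex η then ∏ i, d i else 0 := by
  classical
  have hnd := nondegenerate_of_diag_ne_zero horth hη.type_one_one hc
  have hs : hermIndex η = (negDirs η (⇑w)).card := by
    rw [hermIndex_eq_card_of_orthogonal η hη.type_one_one w c hc horth]
    congr 1; ext ν; simp [mem_negDirs_iff_lt horth]
  split_ifs with hq
  · rw [hq]
    exact hη.finrank_dbarCohomology_hermIndex_eq_prod hχ horth hc hd
      (fun i ↦ hη.pos_of_isPolarizationType Φ hnd hd i)
      (fun n hn ↦ semichar_radical_eq_one_of_nondegenerate hχ hnd n hn)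
  · exact hη.finrank_dbarCohomology_eq_zero_of_ne_index hχ horth hc (by rwa [← hs])

/-- **The analytic Euler characteristic `χ(L) = Σ_{q=0}^{g} (-1)^q dim_ℂ H^{0,q}_{∂̄}(X, L) = (-1)^s d_1 ⋯ d_g`**
for non-degenerate `L` of index `s` and type `(d_1, …, d_g)` (Lange's "`χ(L) = (-1)^s d_1⋯d_g`" in the proof of
Thm. 1.7.3, here from the `∂̄`-cohomology rather than from Thm. 1.6.8 + Thm. 1.6.1 quoted).
[cite: Lange2023AbelianVarietiesComplex, §1.7.2 proof of Thm. 1.7.3] [cite: Lange2023AbelianVarietiesComplex, §1.6.3 Thm. 1.6.8] -/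
theorem IsNSForm.eulerChar_dbarCohomology_eq {d : Fin g → ℕ} (hd : IsPolarizationType Φ η d) :
    ∑ q ∈ Finset.range (g + 1), (-1 : ℤ) ^ q * (Module.finrank ℂ (dbarCohomology Φ η χ (⇑w) q) : ℤ) =
      (-1) ^ hermIndex η * ∏ i, (d i : ℤ) := by
  classical
  have hsg : hermIndex η ≤ g := by
    have h := hermIndex_eq_card_of_orthogonal η hη.type_one_one w c hc horth
    rw [h]
    exact (Finset.card_filter_le _ _).trans (by simp)
  rw [Finset.sum_eq_single (hermIndex η)]
  · rw [hη.finrank_dbarCohomology_eq_ite hχ horth hc hd, if_pos rfl]; push_cast; ring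
  · intro q _ hq
    rw [hη.finrank_dbarCohomology_eq_ite hχ horth hc hd, if_neg hq]; simp
  · intro h; exact absurd (Finset.mem_range.2 (Nat.lt_succ_of_le hsg)) h

/-- **The Riemann–Roch theorem for a non-degenerate line bundle on a complex torus (Lange Thm. 1.7.3 with
Thm. 1.7.1, `∂̄`-cohomology form): `g! · χ(L) = (L^g)`**, where `χ(L) = Σ_q (-1)^q dim_ℂ H^{0,q}_{∂̄}(X, L)`
(this file) and `(L^g) = ∫_X ∧^g c_1(L) = ∫_X (-E)^{∧g} = (-1)^s g! d_1 ⋯ d_g` (row Q81,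
`IsNSForm.torusIntegral_wedgePow_neg_of_isPolarizationType`).
[cite: Lange2023AbelianVarietiesComplex, §1.7.2 Thm. 1.7.3] [cite: Lange2023AbelianVarietiesComplex, §1.7.1 Thm. 1.7.1] -/
theorem IsNSForm.riemannRoch_of_nondegenerate [DecidableEq ι] {d : Fin g → ℕ} (hd : IsPolarizationType Φ η d)
    (e : Fin (2 * g) ≃ ι) :
    (g.factorial : ℂ) * ∑ q ∈ Finset.range (g + 1), (-1 : ℂ) ^ q * (Module.finrank ℂ (dbarCohomology Φ η χ (⇑w) q) : ℂ) =
      torusIntegral Φ e (wedgePow (ofRealForm (-η)) g) := by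
  have hnd := nondegenerate_of_diag_ne_zero horth hη.type_one_one hc
  rw [hη.torusIntegral_wedgePow_neg_of_isPolarizationType Φ hnd hd e]
  have h := hη.eulerChar_dbarCohomology_eq hχ horth hc hd
  have h' : ∑ q ∈ Finset.range (g + 1), (-1 : ℂ) ^ q * (Module.finrank ℂ (dbarCohomology Φ η χ (⇑w) q) : ℂ) =
      (-1) ^ hermIndex η * ∏ i, (d i : ℂ) := by exact_mod_cast congr_arg (Int.cast : ℤ → ℂ) h
  rw [h']
  ring

end RiemannRoch

/-! ## §7 Example: the cohomology of the Poincaré bundle in the `∂̄`-cohomology (Lange §1.6.4 Exercise (4)) -/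

section PoincareBundle

variable {ι : Type*} [Fintype ι] [DecidableEq ι] {E : Type*} [NormedAddCommGroup E] [NormedSpace ℂ E]
  (Φ : (ι → ℝ) ≃L[ℝ] E)

/-- **§1.6.4 Exercise (4) (Lange 2023), "(Cohomology of the Poincaré bundle) `h^q(𝒫) = ℂ` if `q = g`, `0` if
`q ≠ g`", in the `∂̄`-cohomology**: for the Poincaré bundle `𝒫 = L(H_𝒫, χ_𝒫)` on `X × X̂` (row A2-30,
`ComplexTorusPoincareBundle`: `poincareForm`, `poincareChar`) and any `H_𝒫`-orthogonal complex basis `W` of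
`V × Ω̄` (one exists: row Q81 `exists_basis_hermOf_poincareForm`),
`dim_ℂ H^{0,q}_{∂̄}(X × X̂, 𝒫) = 1` if `q = g = dim X` and `= 0` otherwise.  Proof = the hint "show first that `𝒫`
is non-degenerate of index `g`" (row Q81 `exists_apply_ne_zero_poincareForm`, `hermIndex_poincareForm`) with
type `(1, …, 1)` (`isPolarizationType_poincareForm`), and §6's table for non-degenerate bundles.  (Row A2-78's
`finrank_harmonicForms_poincare` is the same count for the harmonic spaces `ℋ^q(𝒫)`.)
[cite: Lange2023AbelianVarietiesComplex, §1.6.4 Exercise (4)] [cite: Lange2023AbelianVarietiesComplex, §1.6.3 Thm. 1.6.8] -/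
theorem finrank_dbarCohomology_poincare {n : ℕ} (W : Module.Basis (Fin n) ℂ (E × (E →L⋆[ℂ] ℂ)))
    (c : Fin n → ℝ) (horth : ∀ i j, hermOf (poincareForm Φ) (W i) (W j) = if i = j then (c i : ℂ) else 0) (q : ℕ) :
    Module.finrank ℂ (dbarCohomology (prodPeriod Φ (dualPeriod Φ)) (poincareForm Φ) (poincareChar Φ) (⇑W) q) =
      if q = Module.finrank ℂ E then 1 else 0 := by
  classical
  haveI : FiniteDimensional ℂ (E × (E →L⋆[ℂ] ℂ)) := Module.Finite.of_basis W
  have hnd := exists_apply_ne_zero_poincareForm Φ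
  have hc : ∀ ν, c ν ≠ 0 := fun ν hν ↦ by
    obtain ⟨x, hx⟩ := hnd (W ν) (W.ne_zero ν)
    exact hx (apply_eq_zero_of_diag_eq_zero horth hν x)
  set σ : Fin n ≃ ι := (Fintype.equivFinOfCardEq (card_eq_of_basis_prod_antidual Φ W)).symm with hσ
  rw [(isNSForm_poincareForm Φ).finrank_dbarCohomology_eq_ite (isSemicharacter_poincareChar Φ) horth hc
    (isPolarizationType_poincareForm Φ σ) q, hermIndex_poincareForm Φ]
  simp

/-- **`H^{0,q}_{∂̄}(X × X̂, 𝒫) = 0` for `q ≠ g`** (the vanishing half of Exercise 1.6.4 (4), as a `Subsingleton`).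
[cite: Lange2023AbelianVarietiesComplex, §1.6.4 Exercise (4)] -/
theorem subsingleton_dbarCohomology_poincare {n : ℕ} (W : Module.Basis (Fin n) ℂ (E × (E →L⋆[ℂ] ℂ)))
    (c : Fin n → ℝ) (horth : ∀ i j, hermOf (poincareForm Φ) (W i) (W j) = if i = j then (c i : ℂ) else 0)
    {q : ℕ} (hq : q ≠ Module.finrank ℂ E) :
    Subsingleton (dbarCohomology (prodPeriod Φ (dualPeriod Φ)) (poincareForm Φ) (poincareChar Φ) (⇑W) q) := by
  classical
  haveI : FiniteDimensional ℂ (E × (E →L⋆[ℂ] ℂ)) := Module.Finite.of_basis W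
  have hnd := exists_apply_ne_zero_poincareForm Φ
  have hc : ∀ ν, c ν ≠ 0 := fun ν hν ↦ by
    obtain ⟨x, hx⟩ := hnd (W ν) (W.ne_zero ν)
    exact hx (apply_eq_zero_of_diag_eq_zero horth hν x)
  have hs : hermIndex (poincareForm Φ) = (negDirs (poincareForm Φ) (⇑W)).card := by
    rw [hermIndex_eq_card_of_orthogonal (poincareForm Φ) (isNSForm_poincareForm Φ).type_one_one W c hc horth]
    congr 1; ext ν; simp [mem_negDirs_iff_lt horth]
  rw [← hermIndex_poincareForm Φ, hs] at hq
  exact (isNSForm_poincareForm Φ).subsingleton_dbarCohomology_of_ne_index (isSemicharacter_poincareChar Φ)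
    horth hc hq

/-- **`χ(𝒫) = Σ_{q=0}^{2g} (-1)^q dim_ℂ H^{0,q}_{∂̄}(X × X̂, 𝒫) = (-1)^g`** (Thm. 1.7.1 for `𝒫`: index `g`, type
`(1, …, 1)`; row A2-78's `harmonicEulerChar_poincare` is the harmonic-space version).
[cite: Lange2023AbelianVarietiesComplex, §1.6.4 Exercise (4)] [cite: Lange2023AbelianVarietiesComplex, §1.7.1 Thm. 1.7.1] -/
theorem eulerChar_dbarCohomology_poincare {n : ℕ} (W : Module.Basis (Fin n) ℂ (E × (E →L⋆[ℂ] ℂ)))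
    (c : Fin n → ℝ) (horth : ∀ i j, hermOf (poincareForm Φ) (W i) (W j) = if i = j then (c i : ℂ) else 0) :
    ∑ q ∈ Finset.range (n + 1), (-1 : ℤ) ^ q *
        (Module.finrank ℂ (dbarCohomology (prodPeriod Φ (dualPeriod Φ)) (poincareForm Φ) (poincareChar Φ) (⇑W) q) : ℤ) =
      (-1) ^ Module.finrank ℂ E := by
  classical
  haveI : FiniteDimensional ℂ (E × (E →L⋆[ℂ] ℂ)) := Module.Finite.of_basis W
  have hnd := exists_apply_ne_zero_poincareForm Φ
  have hc : ∀ ν, c ν ≠ 0 := fun ν hν ↦ by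
    obtain ⟨x, hx⟩ := hnd (W ν) (W.ne_zero ν)
    exact hx (apply_eq_zero_of_diag_eq_zero horth hν x)
  set σ : Fin n ≃ ι := (Fintype.equivFinOfCardEq (card_eq_of_basis_prod_antidual Φ W)).symm with hσ
  rw [(isNSForm_poincareForm Φ).eulerChar_dbarCohomology_eq (isSemicharacter_poincareChar Φ) horth hc
    (isPolarizationType_poincareForm Φ σ), hermIndex_poincareForm Φ]
  simp

end PoincareBundle

/-! ## §8 The Kodaira–Serre symmetry of the table: `h^q(L) = h^{g-q}(L⁻¹)` for non-degenerate `L`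
(Lange §1.6.2 (1.27): "`K_X = 𝒪_X`. Hence the duality gives `H^q(L) ≃ H^{g-q}(L^{-1})`", dimension form) -/

section SerreSymmetry

variable {ι : Type*} [Fintype ι] {E : Type*} [NormedAddCommGroup E] [NormedSpace ℂ E] [FiniteDimensional ℂ E] {g : ℕ}
  {η : E [⋀^Fin 2]→L[ℝ] ℝ} {w : Module.Basis (Fin g) ℂ E} {c : Fin g → ℝ}
  {Φ : (ι → ℝ) ≃L[ℝ] E} {χ : (ι → ℤ) → ℂ}
  (hη : IsNSForm Φ η) (hχ : IsSemicharacter Φ η χ)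
  (horth : ∀ k l, hermOf η (w k) (w l) = if k = l then (c k : ℂ) else 0) (hc : ∀ ν, c ν ≠ 0)
include horth

omit [Fintype ι] [FiniteDimensional ℂ E] in
/-- The frame `e_ν` is `(-H)`-orthogonal as well, with diagonal `-c_ν` (`L⁻¹ = L(-H, χ⁻¹)`).
[cite: Lange2023AbelianVarietiesComplex, §1.6.2 (proof of Thm. 1.6.4, "the hermitian form of `L^{-1}` has `s` positive eigenvalues")] -/
theorem hermOf_neg_basis_basis (k l : Fin g) :
    hermOf (-η) (w k) (w l) = if k = l then ((-c k : ℝ) : ℂ) else 0 := by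
  rw [hermOf_neg, horth]
  split_ifs <;> simp

omit [Fintype ι] in
include hη hc in
/-- **The index of `L⁻¹` is `g - s`**: "since `c_1(L^{-1}) = -c_1(L)`, the hermitian form of `L^{-1}` has `s`
positive eigenvalues" — and, `H` being non-degenerate (`r + s = g`), `g - s` negative ones.
[cite: Lange2023AbelianVarietiesComplex, §1.6.2 (proof of Thm. 1.6.4)] -/
theorem IsNSForm.hermIndex_neg_eq_of_orthogonal : hermIndex (-η) = g - hermIndex η := by
  classical
  have hc' : ∀ ν, -c ν ≠ 0 := fun ν ↦ neg_ne_zero.2 (hc ν)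
  have h1 := hermIndex_eq_card_of_orthogonal (-η) hη.neg.type_one_one w (fun ν ↦ -c ν) hc'
    (hermOf_neg_basis_basis horth)
  have h2 := hermIndex_eq_card_of_orthogonal η hη.type_one_one w c hc horth
  have h3 := (card_posDirs_add_card_negDirs_eq_iff horth).2 hc
  have hP : (Finset.univ.filter fun k ↦ -c k < 0) = posDirs η (⇑w) := by
    ext ν; simp [mem_posDirs, twoForm_I_smul_basis_self horth]
  have hN : (Finset.univ.filter fun k ↦ c k < 0) = negDirs η (⇑w) := by
    ext ν; simp [mem_negDirs_iff_lt horth]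
  rw [h1, hP, h2, hN]
  omega

omit [FiniteDimensional ℂ E] in
include hη hc in
/-- **A non-degenerate `H` with an orthogonal frame of size `g` has a type `(d_1, …, d_g)` (indexed by the
frame's `Fin g`) with all `d_i > 0`** (row Q81's `exists_isPolarizationType_of_nondegenerate`, re-indexed by
`|ι| = 2g`). [cite: Lange2023AbelianVarietiesComplex, §1.5.1 (p0051–p0052)] -/
theorem IsNSForm.exists_isPolarizationType_of_orthogonal :
    ∃ d : Fin g → ℕ, IsPolarizationType Φ η d ∧ ∀ i, 0 < d i := by
  classical
  obtain ⟨g', d, hd, hpos⟩ :=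
    hη.exists_isPolarizationType_of_nondegenerate Φ (nondegenerate_of_diag_ne_zero horth hη.type_one_one hc)
  have hg : g' = g := by
    have h1 := hd.card_eq
    have h2 := card_eq_two_mul_of_basis Φ w
    omega
  subst hg
  exact ⟨d, hd, hpos⟩

include hη hχ hc in
/-- **`h^q(L) = h^{g-q}(L⁻¹)` for a non-degenerate line bundle `L = L(H, χ)` on a complex torus of dimension
`g`, `0 ≤ q ≤ g`** — the dimension form of Lange's "`K_X = 𝒪_X` (1.27). Hence the duality gives
`H^q(L) ≃ H^{g-q}(L^{-1})`", here read off the two tables of §6 (`L` of index `s` and type `d`, `L⁻¹ = L(-H, χ⁻¹)`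
of index `g - s` and the same type): both sides are `d_1 ⋯ d_g` for `q = s` and `0` otherwise.  (The duality
PAIRING on harmonic spaces is row A2-80 / A2-84; this is only the equality of dimensions in the `∂̄`-cohomology.)
[cite: Lange2023AbelianVarietiesComplex, §1.6.2 (1.27)] [cite: Lange2023AbelianVarietiesComplex, §1.6.3 Thm. 1.6.8] -/
theorem IsNSForm.finrank_dbarCohomology_eq_finrank_dbarCohomology_inv {q : ℕ} (hq : q ≤ g) :
    Module.finrank ℂ (dbarCohomology Φ η χ (⇑w) q) =
      Module.finrank ℂ (dbarCohomology Φ (-η) χ⁻¹ (⇑w) (g - q)) := by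
  classical
  obtain ⟨d, hd, -⟩ := hη.exists_isPolarizationType_of_orthogonal horth hc
  have hc' : ∀ ν, -c ν ≠ 0 := fun ν ↦ neg_ne_zero.2 (hc ν)
  have hs : hermIndex η ≤ g := by
    rw [hermIndex_eq_card_of_orthogonal η hη.type_one_one w c hc horth]
    exact (Finset.card_filter_le _ _).trans (by simp)
  rw [hη.finrank_dbarCohomology_eq_ite hχ horth hc hd q,
    hη.neg.finrank_dbarCohomology_eq_ite hχ.inv (hermOf_neg_basis_basis horth) hc' hd.neg (g - q),
    hη.hermIndex_neg_eq_of_orthogonal horth hc]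
  by_cases h : q = hermIndex η
  · rw [if_pos h, if_pos (by rw [h])]
  · rw [if_neg h, if_neg (by omega)]

end SerreSymmetry

/-! ## §9 `χ_∂̄(L) = χ_ℋ(L)` and Corollary 1.7.2 `deg φ_L = det(E|_Λ) = χ(L)²` in the `∂̄`-cohomology,
non-degenerate `L` (junction with row A2-78 `ComplexTorusHarmonicRiemannRoch`) -/

section EulerCharacteristic

variable {ι : Type*} [Fintype ι] [DecidableEq ι] {E : Type*} [NormedAddCommGroup E] [NormedSpace ℂ E]
  [FiniteDimensional ℂ E] {g : ℕ} {η : E [⋀^Fin 2]→L[ℝ] ℝ} {w : Module.Basis (Fin g) ℂ E} {c : Fin g → ℝ}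
  {Φ : (ι → ℝ) ≃L[ℝ] E} {χ : (ι → ℤ) → ℂ}
  (hη : IsNSForm Φ η) (hχ : IsSemicharacter Φ η χ)
  (horth : ∀ k l, hermOf η (w k) (w l) = if k = l then (c k : ℂ) else 0) (hc : ∀ ν, c ν ≠ 0)
include hη hχ horth hc

omit [DecidableEq ι] in
/-- **`χ_∂̄(L) = χ_ℋ(L)`** for non-degenerate `L` and any positive Kähler weights: the Euler characteristic of
the `∂̄`-cohomology (this file) and that of the harmonic spaces (row A2-78, `IsNSForm.harmonicEulerChar`) agree,
degree by degree (Thm. 1.6.1, §5). [cite: Lange2023AbelianVarietiesComplex, §1.7 (p0071)] [cite: Lange2023AbelianVarietiesComplex, §1.6.1 Thm. 1.6.1] -/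
theorem IsNSForm.eulerChar_dbarCohomology_eq_harmonicEulerChar {k : Fin g → ℝ} (hk : ∀ ν, 0 < k ν) :
    ∑ q ∈ Finset.range (g + 1), (-1 : ℤ) ^ q * (Module.finrank ℂ (dbarCohomology Φ η χ (⇑w) q) : ℤ) =
      hη.harmonicEulerChar ⇑w k χ := by
  rw [hη.harmonicEulerChar_def]
  exact Finset.sum_congr rfl fun q _ ↦ by
    rw [hη.finrank_dbarCohomology_eq_finrank_harmonicForms hχ horth hc hk q]

/-- **Corollary 1.7.2 (Lange 2023, "for every `L ∈ Pic(X)`, `deg φ_L = χ(L)²`") in the `∂̄`-cohomology, for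
non-degenerate `L`**: `deg φ_L = det(E|_Λ)` (Prop. 1.4.7; the tree's `polarizationDegree`) equals `χ_∂̄(L)²`
(no type hypothesis: a type exists, §8). [cite: Lange2023AbelianVarietiesComplex, §1.7.1 Cor. 1.7.2] -/
theorem IsNSForm.polarizationDegree_eq_eulerChar_dbarCohomology_sq :
    polarizationDegree Φ η =
      ((∑ q ∈ Finset.range (g + 1), (-1 : ℤ) ^ q * (Module.finrank ℂ (dbarCohomology Φ η χ (⇑w) q) : ℤ) : ℤ) : ℝ) ^ 2 := by
  obtain ⟨d, hd, -⟩ := hη.exists_isPolarizationType_of_orthogonal horth hc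
  rw [hη.eulerChar_dbarCohomology_eq_harmonicEulerChar hχ horth hc (k := fun _ ↦ (1 : ℝ)) (fun _ ↦ one_pos)]
  exact hη.polarizationDegree_eq_harmonicEulerChar_sq hχ horth (fun _ ↦ one_pos) hd

/-- **`#K(L) = χ_∂̄(L)²`** — Cor. 1.7.2 with `deg φ_L = #K(L) = #ker φ_H` (Prop. 1.4.7, the tree's `kerPhiH` of an
integer Gram matrix `G` of `E|_Λ`), non-degenerate `L`. [cite: Lange2023AbelianVarietiesComplex, §1.7.1 Cor. 1.7.2] -/
theorem IsNSForm.natCard_kerPhiH_eq_eulerChar_dbarCohomology_sq {G : Matrix ι ι ℤ}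
    (hG : G.map (Int.cast : ℤ → ℝ) = latticeGram Φ η) :
    (Nat.card (kerPhiH Φ G) : ℤ) =
      (∑ q ∈ Finset.range (g + 1), (-1 : ℤ) ^ q * (Module.finrank ℂ (dbarCohomology Φ η χ (⇑w) q) : ℤ)) ^ 2 := by
  obtain ⟨d, hd, -⟩ := hη.exists_isPolarizationType_of_orthogonal horth hc
  rw [hη.eulerChar_dbarCohomology_eq_harmonicEulerChar hχ horth hc (k := fun _ ↦ (1 : ℝ)) (fun _ ↦ one_pos)]
  exact hη.natCard_kerPhiH_eq_harmonicEulerChar_sq hχ horth (fun _ ↦ one_pos) hd hG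

end EulerCharacteristic

end ComplexTorus

end Literature.Geometry.Kaehler
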